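import Literature.NumberTheory.EllipticCurves.TateFormLevels
import Literature.NumberTheory.EllipticCurves.FormalGroupChart
import HarnessLib

/-!
# Levels add on a Tate form: the chord–tangent law on `y² + xy = x³ + a₄x + a₆`, `|a₄| ≤ |a₆| < 1`

Topic `NumberTheory/EllipticCurves`; sequel of `TateFormLevels` (same setting: a Weierstrass
equation `T` in Tate form for a valuation `w`, here `ℝ≥0`-valued; small points = affine points
with `|x| < 1`, the two branches `|y| < |x|` / `|y + x| < |x|` of the node, middle points
`|x|² ≤ |a₆|`).  That file bounded the number of `E₀`-classes of small points from ABOVE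
(congruences); this file proves the ADDITIVITY of levels — the elementary shadow of Tate's
parametrisation `φ(u) + φ(u') = φ(uu')` (Silverman, *ATAEC*, V.3–V.4): writing `|x(P)|` for the
level of a small point on the first branch,

* `IsTateForm.addX_mul_eq`, `IsTateForm.addY_add_addX_mul_eq` (and the tangent versions
  `…_self`) — the two identities behind everything: for the chord of slope `λ` through
  `(x₁, y₁) ≠ (x₂, y₂)`, with `M = (x₁y₂ - x₂y₁)/(x₁ - x₂)`,
  `x₃ · x₁x₂ = M² - a₆` and `y₃ + x₃ = -(λ x₃ + M)`
  (on the node `y² + xy = x³`, `x = u/(1-u)²`, `y = u²/(1-u)³`, this is `u₃ = u₁u₂`);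
* `add_of_branch₀_of_lt_of_lt_sq` — first branch, levels `|x₁| < |x₂|`, product above the middle
  (`|a₆| < (|x₁||x₂|)²`): `P + Q` is on the first branch at level `|x₁||x₂|`;
  `add_of_branch₀_of_lt_of_sq_lt` — product below the middle: `P + Q` is on the second branch
  with `|x| = |a₆|/(|x₁||x₂|)`; `add_of_branch₀_of_lt_of_sq_eq` — at the middle;
* `two_nsmul_of_branch₀_…` — the same three statements for `2P` (tangent);
* `add_of_branch₁_of_branch₀_of_lt`, `not_isSmall_add_of_branch₁_of_branch₀` — second branch
  `+` first branch: `|x(P + Q)| = |x₁|/|x₂|` (climbing), and `P + Q ∈ E₀` at equal levels;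
* `sub_X_of_branch₀_of_mem_kernel` — **translation by the kernel of reduction**: for `P` small on
  the first branch and `Q ∈ T₁` (`|x(Q)| > 1`, parameter `z(Q) = -x/y`),
  `|x(P + Q) - x(P)| = |x(P)| · |z(Q)|` (on `E_q`: `x(φ(u u₀)) - x(φ(u)) ≈ u (u₀ - 1)`);
* `pow_addOrderOf_eq_of_forall_nsmul` — **the level of a top torsion point**: if `P` is small of
  odd prime order `p`, no small multiple of `P` has larger `|x|`, and the non-small multiples of
  `P` vanish, then `|x(P)|^p = |a₆|` (on `E_q`: `P = φ(ζ q^{1/p})`, `|x(P)|^p = |q| = |a₆(q)|`) —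
  by following `P, 2P, 3P, …` down the first branch to the middle and up the second branch.

Consumer: `MultiplicativeReductionPeuRamifieProofs` (Serre 1987, §2.9 Prop. 5: at a multiplicative
`p` with `p ∣ ord_p Δ_min`, `ρ̄_{E,p}` is peu ramifié — the level `|x(P)| = |Δ|^{1/p} ∈ |K_vˣ|` of a
top `p`-torsion point normalises the Kummer-type witness `x(P)/ϖ^{ord Δ/p}`).

## References

* [SilvermanATAEC1994] J. H. Silverman, *Advanced Topics in the Arithmetic of Elliptic Curves*,
  GTM 151 (1994): V.3 Thm. 3.1, V.4 Lemmas 4.1.1–4.1.4 (PDF pp. 402–405), Cor. IV.9.2(d).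
* [SilvermanAEC2009] J. H. Silverman, *The Arithmetic of Elliptic Curves*, 2nd ed. (2009):
  III.2.3 (the group law), VII.2 (`E₀`, `E₁`).
* [Serre1987] J.-P. Serre, Duke Math. J. 54 (1987), §2.9 Prop. 5.

## Design

`w : Valuation L ℝ≥0` (the consumer's spectral valuation; `FormalGroupChart.kernel` is phrased for
`ℝ≥0`), `[DecidableEq L]` for the group law, theorems only, namespace
`Literature.NumberTheory.EllipticCurves.TateForm` as the prequel.
-/

noncomputable section

open scoped Classical NNReal

namespace Literature.NumberTheory.EllipticCurves

namespace TateForm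

variable {L : Type*} [Field L] {w : Valuation L ℝ≥0} {T : WeierstrassCurve L}

/-! ## §1 The two identities of the chord–tangent law on a Tate form -/

/-- `addY` in Tate form: `y(P + Q) = -(λ (x₃ - x₁) + y₁) - x₃`. [folklore] -/
theorem IsTateForm.addY (hT : IsTateForm w T) (x₁ x₂ y₁ ℓ : L) :
    T.toAffine.addY x₁ x₂ y₁ ℓ =
      -(ℓ * (T.toAffine.addX x₁ x₂ ℓ - x₁) + y₁) - T.toAffine.addX x₁ x₂ ℓ := by
  rw [WeierstrassCurve.Affine.addY, WeierstrassCurve.Affine.negAddY, hT.negY]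

/-- **The chord identity for `x`.**  On a Tate form, for two affine points `(x₁, y₁)`, `(x₂, y₂)`
and `ℓ` with `ℓ (x₁ - x₂) = y₁ - y₂` (the slope when `x₁ ≠ x₂`), the abscissa
`x₃ = ℓ(ℓ + 1) - x₁ - x₂` of the third point satisfies
`x₃ · x₁x₂ · (x₁ - x₂)² = (x₁y₂ - x₂y₁)² - a₆ (x₁ - x₂)²` — i.e. `x₃ x₁ x₂ = M² - a₆` with
`M = (x₁y₂ - x₂y₁)/(x₁ - x₂)`; on the node `y² + xy = x³` (`a₄ = a₆ = 0`, `x = u/(1-u)²`,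
`y = u²/(1-u)³`) this is the multiplicativity `u₃ = u₁u₂` of the parameter. [folklore] -/
theorem IsTateForm.addX_mul_eq (hT : IsTateForm w T) {x₁ y₁ x₂ y₂ ℓ : L}
    (h₁ : T.toAffine.Equation x₁ y₁) (h₂ : T.toAffine.Equation x₂ y₂)
    (hℓ : ℓ * (x₁ - x₂) = y₁ - y₂) :
    T.toAffine.addX x₁ x₂ ℓ * (x₁ * x₂) * (x₁ - x₂) ^ 2 =
      (x₁ * y₂ - x₂ * y₁) ^ 2 - T.a₆ * (x₁ - x₂) ^ 2 := by
  rw [hT.equation_iff] at h₁ h₂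
  rw [hT.addX]
  linear_combination (x₁ * x₂ * ((y₁ - y₂) + ℓ * (x₁ - x₂) + (x₁ - x₂))) * hℓ +
    (x₂ * (x₁ - x₂)) * h₁ + (-(x₁ * (x₁ - x₂))) * h₂

/-- **The chord identity for `y`.**  With the notation of `addX_mul_eq` and
`y₃ = -(λ(x₃ - x₁) + y₁) - x₃`: `(y₃ + x₃)(x₁ - x₂) = -(λ x₃ (x₁ - x₂) + (x₁y₂ - x₂y₁))`, i.e.
`y₃ + x₃ = -(λ x₃ + M)`. [folklore] -/
theorem IsTateForm.addY_add_addX_mul_eq (hT : IsTateForm w T) {x₁ y₁ x₂ y₂ ℓ : L}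
    (hℓ : ℓ * (x₁ - x₂) = y₁ - y₂) :
    (T.toAffine.addY x₁ x₂ y₁ ℓ + T.toAffine.addX x₁ x₂ ℓ) * (x₁ - x₂) =
      -(ℓ * T.toAffine.addX x₁ x₂ ℓ * (x₁ - x₂) + (x₁ * y₂ - x₂ * y₁)) := by
  rw [hT.addY]
  linear_combination x₁ * hℓ

/-- **The tangent identity for `x`.**  On a Tate form, for an affine point `(x₁, y₁)` and `ℓ`
with `ℓ (2y₁ + x₁) = 3x₁² + a₄ - y₁` (the tangent slope when `2y₁ + x₁ ≠ 0`), the abscissa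
`x₃ = ℓ(ℓ + 1) - 2x₁` of `2P` satisfies
`x₃ · x₁² · (2y₁ + x₁)² = (x₁³ - a₄x₁ - 2a₆)² - a₆ (2y₁ + x₁)²` (on the node: `u₃ = u²`).
[folklore] -/
theorem IsTateForm.addX_self_mul_eq (hT : IsTateForm w T) {x₁ y₁ ℓ : L}
    (h₁ : T.toAffine.Equation x₁ y₁) (hℓ : ℓ * (2 * y₁ + x₁) = 3 * x₁ ^ 2 + T.a₄ - y₁) :
    T.toAffine.addX x₁ x₁ ℓ * x₁ ^ 2 * (2 * y₁ + x₁) ^ 2 =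
      (x₁ ^ 3 - T.a₄ * x₁ - 2 * T.a₆) ^ 2 - T.a₆ * (2 * y₁ + x₁) ^ 2 := by
  rw [hT.equation_iff] at h₁
  rw [hT.addX]
  linear_combination (x₁ ^ 2 * (ℓ * (2 * y₁ + x₁) + (3 * x₁ ^ 2 + T.a₄ - y₁) + (2 * y₁ + x₁))) *
    hℓ + (4 * T.a₆ - x₁ ^ 2 - 8 * x₁ ^ 3) * h₁

/-- **The tangent identity for `y`**: `(y₃ + x₃)(2y₁ + x₁) = -λ x₃ (2y₁ + x₁) + (x₁³ - a₄x₁ - 2a₆)`.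
[folklore] -/
theorem IsTateForm.addY_add_addX_self_mul_eq (hT : IsTateForm w T) {x₁ y₁ ℓ : L}
    (h₁ : T.toAffine.Equation x₁ y₁) (hℓ : ℓ * (2 * y₁ + x₁) = 3 * x₁ ^ 2 + T.a₄ - y₁) :
    (T.toAffine.addY x₁ x₁ y₁ ℓ + T.toAffine.addX x₁ x₁ ℓ) * (2 * y₁ + x₁) =
      -(ℓ * T.toAffine.addX x₁ x₁ ℓ * (2 * y₁ + x₁)) + (x₁ ^ 3 - T.a₄ * x₁ - 2 * T.a₆) := by
  rw [hT.equation_iff] at h₁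
  rw [hT.addY]
  linear_combination x₁ * hℓ + (-2) * h₁

/-! ## §2 Sizes of `y` on the two branches -/

/-- `|x³ + a₄x + a₆| ≤ max(|x|³, |a₆|)` for `|x| < 1` on a Tate form. [folklore] -/
theorem IsTateForm.w_rhs_le (hT : IsTateForm w T) {x : L} (hx : w x < 1) :
    w (x ^ 3 + T.a₄ * x + T.a₆) ≤ max (w x ^ 3) (w T.a₆) := by
  refine (Valuation.map_add _ _ _).trans (max_le ((Valuation.map_add _ _ _).trans
    (max_le ?_ ?_)) (le_max_right _ _))
  · rw [map_pow]; exact le_max_left _ _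
  · rw [map_mul]
    calc w T.a₄ * w x ≤ w T.a₆ * 1 := mul_le_mul' hT.w_a₄_le hx.le
      _ = w T.a₆ := mul_one _
      _ ≤ max (w x ^ 3) (w T.a₆) := le_max_right _ _

/-- `|x³ + a₄x + a₆| = |x|³` when `|a₆| < |x|³` (`|x| < 1`). [folklore] -/
theorem IsTateForm.w_rhs_eq_of_lt (hT : IsTateForm w T) {x : L} (hx : w x < 1)
    (h3 : w T.a₆ < w x ^ 3) : w (x ^ 3 + T.a₄ * x + T.a₆) = w x ^ 3 := by
  rw [add_assoc]
  have hx3 : w (x ^ 3) = w x ^ 3 := map_pow _ _ _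
  rw [← hx3]
  refine Valuation.map_add_eq_of_lt_left _ ?_
  rw [hx3]
  refine Valuation.map_add_lt _ ?_ h3
  rw [map_mul]
  calc w T.a₄ * w x ≤ w T.a₆ * 1 := mul_le_mul' hT.w_a₄_le hx.le
    _ = w T.a₆ := mul_one _
    _ < w x ^ 3 := h3

/-- **First branch: `|y + x| = |x|` and `|y| · |x| = |x³ + a₄x + a₆| ≤ max(|x|³, |a₆|)`.**
[cite: SilvermanATAEC1994, V.4 Lemma 4.1.2] -/
theorem IsTateForm.branch₀_w (hT : IsTateForm w T) {x y : L} (h : T.toAffine.Equation x y)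
    (hx : w x < 1) (hy : w y < w x) :
    w (y + x) = w x ∧ w y * w x = w (x ^ 3 + T.a₄ * x + T.a₆) ∧
      w y * w x ≤ max (w x ^ 3) (w T.a₆) := by
  have hyx : w (y + x) = w x := Valuation.map_add_eq_of_lt_right _ hy
  have e := (hT.equation_iff x y).mp h
  have hprod : w y * w (y + x) = w (x ^ 3 + T.a₄ * x + T.a₆) := by
    rw [← map_mul, show y * (y + x) = x ^ 3 + T.a₄ * x + T.a₆ by linear_combination e]
  rw [hyx] at hprod
  exact ⟨hyx, hprod, hprod ▸ hT.w_rhs_le hx⟩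

/-- First branch, quantitative: `|y| ≤ max(|x|², |a₆|/|x|)`, and `|y| < |x|`; if `|a₆| < |x|³`
then `|y| = |x|²`. [cite: SilvermanATAEC1994, V.4 Lemma 4.1.2] -/
theorem IsTateForm.branch₀_w_y_le (hT : IsTateForm w T) {x y : L} (h : T.toAffine.Equation x y)
    (hx : w x < 1) (hy : w y < w x) :
    w y * w x ≤ max (w x ^ 3) (w T.a₆) ∧ (w T.a₆ < w x ^ 3 → w y = w x ^ 2) := by
  obtain ⟨-, hprod, hle⟩ := hT.branch₀_w h hx hy
  refine ⟨hle, fun h3 ↦ ?_⟩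
  have hx0 : 0 < w x := lt_of_le_of_lt zero_le hy
  rw [hT.w_rhs_eq_of_lt hx h3] at hprod
  have : w y * w x = w x ^ 2 * w x := by rw [hprod]; ring
  exact mul_right_cancel₀ hx0.ne' this

/-- **Second branch: `|y| = |x|` and `|y + x| · |x| = |x³ + a₄x + a₆| ≤ max(|x|³, |a₆|)`.**
[cite: SilvermanATAEC1994, V.4 Lemma 4.1.2] -/
theorem IsTateForm.branch₁_w (hT : IsTateForm w T) {x y : L} (h : T.toAffine.Equation x y)
    (hx : w x < 1) (hy : w (y + x) < w x) :
    w y = w x ∧ w (y + x) * w x ≤ max (w x ^ 3) (w T.a₆) := by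
  have hyx : w y = w x := by
    have := Valuation.map_sub_eq_of_lt_left w hy
    rwa [Valuation.map_sub_swap, add_sub_cancel_right] at this
  have e := (hT.equation_iff x y).mp h
  have hprod : w y * w (y + x) = w (x ^ 3 + T.a₄ * x + T.a₆) := by
    rw [← map_mul, show y * (y + x) = x ^ 3 + T.a₄ * x + T.a₆ by linear_combination e]
  rw [hyx, mul_comm] at hprod
  exact ⟨hyx, hprod ▸ hT.w_rhs_le hx⟩

/-- A Tate form is `w`-integral (`a₁ = 1`, `a₂ = a₃ = 0`, `|a₄| ≤ |a₆| < 1`). [folklore] -/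
theorem IsTateForm.isIntegral (hT : IsTateForm w T) : T.IsIntegral w.integer := by
  refine WeierstrassCurve.isIntegral_of_exists_lift _ ⟨⟨T.a₁, ?_⟩, rfl⟩ ⟨⟨T.a₂, ?_⟩, rfl⟩
    ⟨⟨T.a₃, ?_⟩, rfl⟩ ⟨⟨T.a₄, ?_⟩, rfl⟩ ⟨⟨T.a₆, ?_⟩, rfl⟩ <;> rw [Valuation.mem_integer_iff]
  · rw [hT.a₁, map_one]
  · rw [hT.a₂, map_zero]; exact zero_le_one
  · rw [hT.a₃, map_zero]; exact zero_le_one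
  · exact hT.w_a₄_le.trans hT.w_a₆_lt.le
  · exact hT.w_a₆_lt.le

/-! ## §3 The chord and the tangent in valuation form -/

/-- `|2| ≤ 1`-free bookkeeping: `a² < c` and `b² < c` give `|u - v|² < c` when `|u| = a`, `|v| = b`.
[folklore] -/
theorem w_sub_sq_lt {u v : L} {c : ℝ≥0} (hu : w u ^ 2 < c) (hv : w v ^ 2 < c) :
    w (u - v) ^ 2 < c := by
  rcases le_total (w u) (w v) with h | h
  · exact lt_of_le_of_lt (pow_le_pow_left' ((Valuation.map_sub w u v).trans (max_le h le_rfl)) 2) hv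
  · exact lt_of_le_of_lt (pow_le_pow_left' ((Valuation.map_sub w u v).trans (max_le le_rfl h)) 2) hu

/-- Same with `≤`. [folklore] -/
theorem w_sub_sq_le {u v : L} {c : ℝ≥0} (hu : w u ^ 2 ≤ c) (hv : w v ^ 2 ≤ c) :
    w (u - v) ^ 2 ≤ c := by
  rcases le_total (w u) (w v) with h | h
  · exact (pow_le_pow_left' ((Valuation.map_sub w u v).trans (max_le h le_rfl)) 2).trans hv
  · exact (pow_le_pow_left' ((Valuation.map_sub w u v).trans (max_le le_rfl h)) 2).trans hu

section GroupLaw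

variable [DecidableEq L]

/-- The chord through two affine points with `x₁ ≠ x₂`: Mathlib's slope `λ` satisfies
`λ (x₁ - x₂) = y₁ - y₂`, and the two identities of §1 read, after taking `w`,
`|x₃| |x₁x₂| |x₁ - x₂|² = |(x₁y₂ - x₂y₁)² - a₆(x₁ - x₂)²|` and
`|y₃ + x₃| |x₁ - x₂| = |λ x₃ (x₁ - x₂) + (x₁y₂ - x₂y₁)|`. [folklore] -/
theorem IsTateForm.chord_w (hT : IsTateForm w T) {x₁ y₁ x₂ y₂ : L}
    (h₁ : T.toAffine.Equation x₁ y₁) (h₂ : T.toAffine.Equation x₂ y₂) (hxne : x₁ ≠ x₂) :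
    T.toAffine.slope x₁ x₂ y₁ y₂ * (x₁ - x₂) = y₁ - y₂ ∧
    w (T.toAffine.addX x₁ x₂ (T.toAffine.slope x₁ x₂ y₁ y₂)) * (w x₁ * w x₂) * w (x₁ - x₂) ^ 2 =
      w ((x₁ * y₂ - x₂ * y₁) ^ 2 - T.a₆ * (x₁ - x₂) ^ 2) ∧
    w (T.toAffine.addY x₁ x₂ y₁ (T.toAffine.slope x₁ x₂ y₁ y₂) +
        T.toAffine.addX x₁ x₂ (T.toAffine.slope x₁ x₂ y₁ y₂)) * w (x₁ - x₂) =
      w (T.toAffine.slope x₁ x₂ y₁ y₂ * T.toAffine.addX x₁ x₂ (T.toAffine.slope x₁ x₂ y₁ y₂) *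
        (x₁ - x₂) + (x₁ * y₂ - x₂ * y₁)) := by
  have hℓ : T.toAffine.slope x₁ x₂ y₁ y₂ * (x₁ - x₂) = y₁ - y₂ := by
    rw [WeierstrassCurve.Affine.slope_of_X_ne hxne, div_mul_cancel₀ _ (sub_ne_zero.mpr hxne)]
  refine ⟨hℓ, ?_, ?_⟩
  · have := congrArg w (hT.addX_mul_eq h₁ h₂ hℓ)
    rwa [map_mul, map_mul, map_mul, map_pow] at this
  · have := congrArg w (hT.addY_add_addX_mul_eq (x₁ := x₁) (x₂ := x₂) (y₁ := y₁) (y₂ := y₂) hℓ)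
    rwa [map_mul, Valuation.map_neg] at this

/-- The tangent at an affine point of the first branch (`|y₁| < |x₁|`, so `2y₁ + x₁ ≠ 0` and
`y₁ ≠ -y₁ - x₁`): Mathlib's slope `λ` satisfies `λ (2y₁ + x₁) = 3x₁² + a₄ - y₁`,
`|2y₁ + x₁| = |x₁|`,
and the tangent identities of §1 read `|x₃| |x₁|² |x₁|² = |N² - a₆(2y₁ + x₁)²|`,
`|y₃ + x₃| |x₁| = |-(λ x₃ (2y₁ + x₁)) + N|`, `N = x₁³ - a₄x₁ - 2a₆`. [folklore] -/
theorem IsTateForm.tangent_w (hT : IsTateForm w T) {x₁ y₁ : L}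
    (h₁ : T.toAffine.Equation x₁ y₁) (hy₁ : w y₁ < w x₁) :
    y₁ ≠ T.toAffine.negY x₁ y₁ ∧ w (2 * y₁ + x₁) = w x₁ ∧
    T.toAffine.slope x₁ x₁ y₁ y₁ * (2 * y₁ + x₁) = 3 * x₁ ^ 2 + T.a₄ - y₁ ∧
    w (T.toAffine.addX x₁ x₁ (T.toAffine.slope x₁ x₁ y₁ y₁)) * w x₁ ^ 2 * w x₁ ^ 2 =
      w ((x₁ ^ 3 - T.a₄ * x₁ - 2 * T.a₆) ^ 2 - T.a₆ * (2 * y₁ + x₁) ^ 2) ∧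
    w (T.toAffine.addY x₁ x₁ y₁ (T.toAffine.slope x₁ x₁ y₁ y₁) +
        T.toAffine.addX x₁ x₁ (T.toAffine.slope x₁ x₁ y₁ y₁)) * w x₁ =
      w (-(T.toAffine.slope x₁ x₁ y₁ y₁ * T.toAffine.addX x₁ x₁ (T.toAffine.slope x₁ x₁ y₁ y₁) *
        (2 * y₁ + x₁)) + (x₁ ^ 3 - T.a₄ * x₁ - 2 * T.a₆)) := by
  have hD : w (2 * y₁ + x₁) = w x₁ := by
    refine Valuation.map_add_eq_of_lt_right _ ?_
    rw [map_mul]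
    calc w 2 * w y₁ ≤ 1 * w y₁ := by
          refine mul_le_mul_left ?_ _
          have h := Valuation.map_add w 1 1
          rw [Valuation.map_one, max_self, one_add_one_eq_two] at h
          exact h
      _ = w y₁ := one_mul _
      _ < w x₁ := hy₁
  have hD0 : 2 * y₁ + x₁ ≠ 0 := by
    intro h0
    rw [h0, map_zero] at hD
    exact (lt_of_le_of_lt zero_le hy₁).ne hD
  have hneg : y₁ ≠ T.toAffine.negY x₁ y₁ := by
    rw [hT.negY]
    intro h
    apply hD0
    linear_combination h
  have hℓ : T.toAffine.slope x₁ x₁ y₁ y₁ * (2 * y₁ + x₁) = 3 * x₁ ^ 2 + T.a₄ - y₁ := by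
    rw [WeierstrassCurve.Affine.slope_of_Y_ne rfl hneg, hT.negY, hT.a₁, hT.a₂,
      show y₁ - (-y₁ - x₁) = 2 * y₁ + x₁ by ring, div_mul_cancel₀ _ hD0]
    ring
  refine ⟨hneg, hD, hℓ, ?_, ?_⟩
  · have := congrArg w (hT.addX_self_mul_eq h₁ hℓ)
    rwa [map_mul, map_mul, map_pow, map_pow, hD] at this
  · have := congrArg w (hT.addY_add_addX_self_mul_eq h₁ hℓ)
    rwa [map_mul, hD] at this

/-! ### First branch + first branch, different levels -/

/-- Common estimates for two first-branch small points at levels `|x₁| < |x₂|` (`|a₆| < |x₁|²`):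
`|x₁ - x₂| = |x₂|`, `|y₁| |x₁| ≤ max(|x₁|³, |a₆|)`, `|y₂| |x₂| ≤ max(|x₂|³, |a₆|)`, `|λ| < 1`.
[folklore] -/
theorem branch₀_pair {x₁ y₁ x₂ y₂ : L}
    (hlt : w x₁ < w x₂) (hy₁ : w y₁ < w x₁) (hy₂ : w y₂ < w x₂) :
    x₁ ≠ x₂ ∧ w (x₁ - x₂) = w x₂ ∧ w (T.toAffine.slope x₁ x₂ y₁ y₂) < 1 := by
  have hxne : x₁ ≠ x₂ := fun h ↦ hlt.ne (by rw [h])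
  have hD : w (x₁ - x₂) = w x₂ := Valuation.map_sub_eq_of_lt_right _ hlt
  refine ⟨hxne, hD, ?_⟩
  have hx0 : 0 < w x₂ := lt_of_le_of_lt zero_le hlt
  rw [WeierstrassCurve.Affine.slope_of_X_ne hxne, map_div₀, hD, div_lt_one₀ hx0]
  exact lt_of_le_of_lt (Valuation.map_sub w y₁ y₂) (max_lt (hy₁.trans hlt) hy₂)

/-- **Levels add on the first branch (above the middle).**  On a Tate form let `P = (x₁, y₁)`,
`Q = (x₂, y₂)` be small points on the first branch (`|yᵢ| < |xᵢ|`) at levels `|x₁| < |x₂|`, with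
`|a₆| < |x₁|²` and `|a₆| < (|x₁||x₂|)²`.  Then `P + Q = (x₃, y₃)` is a small point on the first
branch at level `|x₃| = |x₁| |x₂|` (on `E_q`: `φ(u₁) + φ(u₂) = φ(u₁u₂)` with
`|u₁u₂| > |q|^{1/2}`; Silverman, *ATAEC*, V.4 Lemma 4.1.2).
[cite: SilvermanATAEC1994, V.4 Lemmas 4.1.1–4.1.2 (PDF pp. 402–403)] -/
theorem add_of_branch₀_of_lt_of_lt_sq (hT : IsTateForm w T) {x₁ y₁ x₂ y₂ : L}
    (h₁ : T.toAffine.Nonsingular x₁ y₁) (h₂ : T.toAffine.Nonsingular x₂ y₂)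
    (hx₂ : w x₂ < 1) (hlt : w x₁ < w x₂) (hm₁ : w T.a₆ < w x₁ ^ 2)
    (hy₁ : w y₁ < w x₁) (hy₂ : w y₂ < w x₂) (hprod : w T.a₆ < (w x₁ * w x₂) ^ 2) :
    ∃ (x₃ y₃ : L) (h₃ : T.toAffine.Nonsingular x₃ y₃),
      (.some x₁ y₁ h₁ : T.toAffine.Point) + .some x₂ y₂ h₂ = .some x₃ y₃ h₃ ∧
      w x₃ = w x₁ * w x₂ ∧ w y₃ < w x₃ := by
  obtain ⟨hxne, hD, hℓ1⟩ := branch₀_pair (T := T) hlt hy₁ hy₂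
  obtain ⟨hℓ, hX, hY⟩ := hT.chord_w h₁.1 h₂.1 hxne
  set s₁ := w x₁ with hs₁
  set s₂ := w x₂ with hs₂
  set n₀ := w T.a₆ with hn₀
  have hx₁ : s₁ < 1 := hlt.trans hx₂
  have hs₁0 : 0 < s₁ := w_x_pos_of_lt_sq hm₁
  have hs₂0 : 0 < s₂ := lt_trans hs₁0 hlt
  -- `|a₆| < |x₁|² |x₂|`, `|a₆| < |x₂|³`
  have hn12 : n₀ < s₁ ^ 2 * s₂ := by
    calc n₀ < (s₁ * s₂) ^ 2 := hprod
      _ = s₁ ^ 2 * s₂ * s₂ := by ring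
      _ ≤ s₁ ^ 2 * s₂ * 1 := mul_le_mul_of_nonneg_left hx₂.le zero_le
      _ = s₁ ^ 2 * s₂ := mul_one _
  have hn2 : n₀ < s₂ ^ 3 := by
    calc n₀ < s₁ ^ 2 * s₂ := hn12
      _ < s₂ ^ 2 * s₂ := by
          refine mul_lt_mul_of_pos_right (pow_lt_pow_left₀ hlt zero_le two_ne_zero) hs₂0
      _ = s₂ ^ 3 := by ring
  -- `|y₂| = |x₂|²`, `|y₁| < |x₁||x₂|`
  have hwy₂ : w y₂ = s₂ ^ 2 := (hT.branch₀_w_y_le h₂.1 hx₂ hy₂).2 hn2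
  have hwy₁ : w y₁ < s₁ * s₂ := by
    have hle := (hT.branch₀_w_y_le h₁.1 hx₁ hy₁).1
    have hlt' : max (s₁ ^ 3) n₀ < s₁ * s₂ * s₁ := by
      refine max_lt ?_ ?_
      · calc s₁ ^ 3 = s₁ * s₁ * s₁ := by ring
          _ < s₁ * s₂ * s₁ := by
              refine mul_lt_mul_of_pos_right (mul_lt_mul_of_pos_left hlt hs₁0) hs₁0
      · calc n₀ < s₁ ^ 2 * s₂ := hn12
          _ = s₁ * s₂ * s₁ := by ring
    exact lt_of_mul_lt_mul_right (lt_of_le_of_lt hle hlt') zero_le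
  -- the numerator `x₁y₂ - x₂y₁` has `|·| = |x₁||x₂|²`
  have hN : w (x₁ * y₂ - x₂ * y₁) = s₁ * s₂ ^ 2 := by
    have h1 : w (x₁ * y₂) = s₁ * s₂ ^ 2 := by rw [map_mul, hwy₂]
    have h2 : w (x₂ * y₁) < w (x₁ * y₂) := by
      rw [h1, map_mul]
      calc s₂ * w y₁ < s₂ * (s₁ * s₂) := mul_lt_mul_of_pos_left hwy₁ hs₂0
        _ = s₁ * s₂ ^ 2 := by ring
    rw [Valuation.map_sub_eq_of_lt_left _ h2, h1]
  -- the right-hand side of the `x`-identity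
  have hR : w ((x₁ * y₂ - x₂ * y₁) ^ 2 - T.a₆ * (x₁ - x₂) ^ 2) = (s₁ * s₂ ^ 2) ^ 2 := by
    have h1 : w ((x₁ * y₂ - x₂ * y₁) ^ 2) = (s₁ * s₂ ^ 2) ^ 2 := by rw [map_pow, hN]
    rw [Valuation.map_sub_eq_of_lt_left _ (by
      rw [h1, map_mul, map_pow, hD]
      calc n₀ * s₂ ^ 2 < (s₁ * s₂) ^ 2 * s₂ ^ 2 := mul_lt_mul_of_pos_right hprod (pow_pos hs₂0 2)
        _ = (s₁ * s₂ ^ 2) ^ 2 := by ring), h1]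
  -- hence `|x₃| = |x₁||x₂|`
  set x₃ := T.toAffine.addX x₁ x₂ (T.toAffine.slope x₁ x₂ y₁ y₂) with hx₃
  set y₃ := T.toAffine.addY x₁ x₂ y₁ (T.toAffine.slope x₁ x₂ y₁ y₂) with hy₃
  rw [hR, hD] at hX
  have hwx₃ : w x₃ = s₁ * s₂ := by
    have hK : (s₁ * s₂) * s₂ ^ 2 ≠ 0 := by positivity
    apply mul_right_cancel₀ hK
    calc w x₃ * (s₁ * s₂ * s₂ ^ 2) = w x₃ * (s₁ * s₂) * s₂ ^ 2 := by ring
      _ = (s₁ * s₂ ^ 2) ^ 2 := hX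
      _ = s₁ * s₂ * (s₁ * s₂ * s₂ ^ 2) := by ring
  -- and `|y₃ + x₃| = |x₃|`, so `P + Q` is on the first branch
  have hwyx : w (y₃ + x₃) = w x₃ := by
    have h1 : w (T.toAffine.slope x₁ x₂ y₁ y₂ * x₃ * (x₁ - x₂)) < w (x₁ * y₂ - x₂ * y₁) := by
      rw [map_mul, map_mul, hwx₃, hD, hN]
      calc w (T.toAffine.slope x₁ x₂ y₁ y₂) * (s₁ * s₂) * s₂ < 1 * (s₁ * s₂) * s₂ :=
            mul_lt_mul_of_pos_right (mul_lt_mul_of_pos_right hℓ1 (mul_pos hs₁0 hs₂0)) hs₂0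
        _ = s₁ * s₂ ^ 2 := by ring
    rw [Valuation.map_add_eq_of_lt_right _ h1, hN, hD] at hY
    apply mul_right_cancel₀ hs₂0.ne'
    rw [hY, hwx₃]; ring
  have hx₃1 : w x₃ < 1 := by
    rw [hwx₃]
    calc s₁ * s₂ < 1 * 1 := mul_lt_mul'' hx₁ hx₂ zero_le zero_le
      _ = 1 := mul_one _
  have hmid₃ : w T.a₆ < w x₃ ^ 2 := by rw [hwx₃]; exact hprod
  refine ⟨x₃, y₃, _, WeierstrassCurve.Affine.Point.add_of_X_ne hxne, hwx₃, ?_⟩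
  rcases branch hT (WeierstrassCurve.Affine.equation_add h₁.1 h₂.1 fun hxy ↦ hxne hxy.1) hx₃1 hmid₃
    with hb | hb
  · exact hb.1
  · exact absurd hwyx (ne_of_lt hb.1)

/-- **Crossing the middle on the first branch.**  As in `add_of_branch₀_of_lt_of_lt_sq`, but with
`(|x₁||x₂|)² < |a₆|`: then `P + Q = (x₃, y₃)` is a small point on the SECOND branch with
`|x₃| |x₁| |x₂| = |a₆|` (on `E_q`: `|u₁u₂| < |q|^{1/2}` and `x(φ(u₁u₂)) ≈ q/(u₁u₂)`; Silverman,
*ATAEC*, V.4 Lemma 4.1.3). [cite: SilvermanATAEC1994, V.4 Lemmas 4.1.1–4.1.3 (PDF pp. 402–404)] -/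
theorem add_of_branch₀_of_lt_of_sq_lt (hT : IsTateForm w T) {x₁ y₁ x₂ y₂ : L}
    (h₁ : T.toAffine.Nonsingular x₁ y₁) (h₂ : T.toAffine.Nonsingular x₂ y₂)
    (hx₂ : w x₂ < 1) (hlt : w x₁ < w x₂) (hm₁ : w T.a₆ < w x₁ ^ 2)
    (hy₁ : w y₁ < w x₁) (hy₂ : w y₂ < w x₂) (hprod : (w x₁ * w x₂) ^ 2 < w T.a₆) :
    ∃ (x₃ y₃ : L) (h₃ : T.toAffine.Nonsingular x₃ y₃),
      (.some x₁ y₁ h₁ : T.toAffine.Point) + .some x₂ y₂ h₂ = .some x₃ y₃ h₃ ∧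
      w x₃ * (w x₁ * w x₂) = w T.a₆ ∧ w (y₃ + x₃) < w x₃ := by
  obtain ⟨hxne, hD, hℓ1⟩ := branch₀_pair (T := T) hlt hy₁ hy₂
  obtain ⟨hℓ, hX, hY⟩ := hT.chord_w h₁.1 h₂.1 hxne
  set s₁ := w x₁ with hs₁
  set s₂ := w x₂ with hs₂
  set n₀ := w T.a₆ with hn₀
  have hx₁ : s₁ < 1 := hlt.trans hx₂
  have hs₁0 : 0 < s₁ := w_x_pos_of_lt_sq hm₁
  have hs₂0 : 0 < s₂ := lt_trans hs₁0 hlt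
  have hm₂ : n₀ < s₂ ^ 2 := hm₁.trans (pow_lt_pow_left₀ hlt zero_le two_ne_zero)
  have hn0 : 0 < n₀ := lt_of_le_of_lt zero_le hprod
  -- `|x₁y₂|² < |a₆||x₂|²` and `|x₂y₁|² < |a₆||x₂|²`
  have hA : w (x₁ * y₂) ^ 2 < n₀ * s₂ ^ 2 := by
    have hle := (hT.branch₀_w_y_le h₂.1 hx₂ hy₂).1
    -- `(|x₁||y₂|)² |x₂|² = |x₁|² (|y₂||x₂|)² ≤ |x₁|² max(|x₂|³,|a₆|)² < |a₆| |x₂|⁴`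
    have h1 : (s₁ * (w y₂ * s₂)) ^ 2 < n₀ * s₂ ^ 2 * s₂ ^ 2 := by
      have h2 : (s₁ * (w y₂ * s₂)) ^ 2 ≤ (s₁ * max (s₂ ^ 3) n₀) ^ 2 :=
        pow_le_pow_left' (mul_le_mul_of_nonneg_left hle zero_le) 2
      refine lt_of_le_of_lt h2 ?_
      rcases le_total (s₂ ^ 3) n₀ with h3 | h3
      · rw [max_eq_right h3]
        calc (s₁ * n₀) ^ 2 = (s₁ ^ 2 * n₀) * n₀ := by ring
          _ < (s₂ ^ 2 * s₂ ^ 2) * n₀ := by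
              refine mul_lt_mul_of_pos_right ?_ hn0
              exact mul_lt_mul'' (pow_lt_pow_left₀ hlt zero_le two_ne_zero) hm₂ zero_le zero_le
          _ = n₀ * s₂ ^ 2 * s₂ ^ 2 := by ring
      · rw [max_eq_left h3]
        calc (s₁ * s₂ ^ 3) ^ 2 = (s₁ * s₂) ^ 2 * (s₂ ^ 2 * s₂ ^ 2) := by ring
          _ < n₀ * (s₂ ^ 2 * s₂ ^ 2) := mul_lt_mul_of_pos_right hprod (by positivity)
          _ = n₀ * s₂ ^ 2 * s₂ ^ 2 := by ring
    rw [map_mul]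
    have h4 : (s₁ * w y₂) ^ 2 * s₂ ^ 2 < n₀ * s₂ ^ 2 * s₂ ^ 2 := by
      calc (s₁ * w y₂) ^ 2 * s₂ ^ 2 = (s₁ * (w y₂ * s₂)) ^ 2 := by ring
        _ < n₀ * s₂ ^ 2 * s₂ ^ 2 := h1
    exact lt_of_mul_lt_mul_right h4 zero_le
  have hB : w (x₂ * y₁) ^ 2 < n₀ * s₂ ^ 2 := by
    have hle := (hT.branch₀_w_y_le h₁.1 hx₁ hy₁).1
    have h1 : (w y₁ * s₁) ^ 2 < n₀ * s₁ ^ 2 := by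
      refine lt_of_le_of_lt (pow_le_pow_left' hle 2) ?_
      rcases le_total (s₁ ^ 3) n₀ with h3 | h3
      · rw [max_eq_right h3]
        calc n₀ ^ 2 = n₀ * n₀ := sq n₀
          _ < n₀ * s₁ ^ 2 := mul_lt_mul_of_pos_left hm₁ hn0
      · rw [max_eq_left h3]
        have h5 : s₁ ^ 4 < n₀ := by
          calc s₁ ^ 4 = (s₁ * s₁) ^ 2 := by ring
            _ ≤ (s₁ * s₂) ^ 2 := pow_le_pow_left' (mul_le_mul_of_nonneg_left hlt.le zero_le) 2
            _ < n₀ := hprod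
        calc (s₁ ^ 3) ^ 2 = s₁ ^ 4 * s₁ ^ 2 := by ring
          _ < n₀ * s₁ ^ 2 := mul_lt_mul_of_pos_right h5 (pow_pos hs₁0 2)
    rw [map_mul]
    have h2 : (s₂ * w y₁) ^ 2 * s₁ ^ 2 < n₀ * s₂ ^ 2 * s₁ ^ 2 := by
      calc (s₂ * w y₁) ^ 2 * s₁ ^ 2 = (w y₁ * s₁) ^ 2 * s₂ ^ 2 := by ring
        _ < n₀ * s₁ ^ 2 * s₂ ^ 2 := mul_lt_mul_of_pos_right h1 (pow_pos hs₂0 2)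
        _ = n₀ * s₂ ^ 2 * s₁ ^ 2 := by ring
    exact lt_of_mul_lt_mul_right h2 zero_le
  have hN2 : w ((x₁ * y₂ - x₂ * y₁) ^ 2) < w (T.a₆ * (x₁ - x₂) ^ 2) := by
    rw [map_pow, map_mul, map_pow, hD]
    exact w_sub_sq_lt hA hB
  have hR : w ((x₁ * y₂ - x₂ * y₁) ^ 2 - T.a₆ * (x₁ - x₂) ^ 2) = n₀ * s₂ ^ 2 := by
    rw [Valuation.map_sub_eq_of_lt_right _ hN2, map_mul, map_pow, hD]
  set x₃ := T.toAffine.addX x₁ x₂ (T.toAffine.slope x₁ x₂ y₁ y₂) with hx₃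
  set y₃ := T.toAffine.addY x₁ x₂ y₁ (T.toAffine.slope x₁ x₂ y₁ y₂) with hy₃
  rw [hR, hD] at hX
  have hwx₃ : w x₃ * (s₁ * s₂) = n₀ := by
    apply mul_right_cancel₀ (pow_pos hs₂0 2).ne'
    exact hX
  have hx₃0 : 0 < w x₃ := by
    refine lt_of_le_of_ne zero_le fun h0 ↦ ?_
    rw [← h0, zero_mul] at hwx₃
    exact hn0.ne hwx₃
  -- second branch: both terms of `(y₃ + x₃)(x₁ - x₂)` are `< |x₃||x₂|`
  have hNlt : w (x₁ * y₂ - x₂ * y₁) < w x₃ * s₂ := by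
    have h1 : w (x₁ * y₂ - x₂ * y₁) ^ 2 < n₀ * s₂ ^ 2 := w_sub_sq_lt hA hB
    have h2 : n₀ * s₂ ^ 2 ≤ (w x₃ * s₂) ^ 2 := by
      -- `n₀ s₂² ≤ (n₀/(s₁s₂))² s₂²` iff `(s₁s₂)² ≤ n₀`
      have h3 : n₀ * s₂ ^ 2 * (s₁ * s₂) ^ 2 ≤ (w x₃ * s₂) ^ 2 * (s₁ * s₂) ^ 2 := by
        calc n₀ * s₂ ^ 2 * (s₁ * s₂) ^ 2 ≤ n₀ * s₂ ^ 2 * n₀ :=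
              mul_le_mul_of_nonneg_left hprod.le zero_le
          _ = (w x₃ * (s₁ * s₂)) ^ 2 * s₂ ^ 2 := by rw [hwx₃]; ring
          _ = (w x₃ * s₂) ^ 2 * (s₁ * s₂) ^ 2 := by ring
      exact le_of_mul_le_mul_right h3 (by positivity)
    exact lt_of_pow_lt_pow_left₀ 2 zero_le (lt_of_lt_of_le h1 h2)
  have hLlt : w (T.toAffine.slope x₁ x₂ y₁ y₂ * x₃ * (x₁ - x₂)) < w x₃ * s₂ := by
    rw [map_mul, map_mul, hD]
    calc w (T.toAffine.slope x₁ x₂ y₁ y₂) * w x₃ * s₂ < 1 * w x₃ * s₂ :=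
          mul_lt_mul_of_pos_right (mul_lt_mul_of_pos_right hℓ1 hx₃0) hs₂0
      _ = w x₃ * s₂ := by rw [one_mul]
  have hwyx : w (y₃ + x₃) < w x₃ := by
    have h1 : w (y₃ + x₃) * s₂ < w x₃ * s₂ := by
      rw [hD] at hY
      rw [hY]
      exact lt_of_le_of_lt (Valuation.map_add _ _ _) (max_lt hLlt hNlt)
    exact lt_of_mul_lt_mul_right h1 zero_le
  exact ⟨x₃, y₃, _, WeierstrassCurve.Affine.Point.add_of_X_ne hxne, hwx₃, hwyx⟩

/-- **At the middle.**  As in `add_of_branch₀_of_lt_of_lt_sq`, but with `(|x₁||x₂|)² = |a₆|`: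
`P + Q = (x₃, y₃)` is a small point with `|x₃|² ≤ |a₆|` (a "middle" point, `TateFormLevels`).
[cite: SilvermanATAEC1994, V.4 Lemma 4.1.4 (PDF p. 405)] -/
theorem add_of_branch₀_of_lt_of_sq_eq (hT : IsTateForm w T) {x₁ y₁ x₂ y₂ : L}
    (h₁ : T.toAffine.Nonsingular x₁ y₁) (h₂ : T.toAffine.Nonsingular x₂ y₂)
    (hx₂ : w x₂ < 1) (hlt : w x₁ < w x₂) (hm₁ : w T.a₆ < w x₁ ^ 2)
    (hy₁ : w y₁ < w x₁) (hy₂ : w y₂ < w x₂) (hprod : (w x₁ * w x₂) ^ 2 = w T.a₆) :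
    ∃ (x₃ y₃ : L) (h₃ : T.toAffine.Nonsingular x₃ y₃),
      (.some x₁ y₁ h₁ : T.toAffine.Point) + .some x₂ y₂ h₂ = .some x₃ y₃ h₃ ∧
      w x₃ ^ 2 ≤ w T.a₆ ∧ w x₃ < 1 := by
  obtain ⟨hxne, hD, -⟩ := branch₀_pair (T := T) hlt hy₁ hy₂
  obtain ⟨hℓ, hX, -⟩ := hT.chord_w h₁.1 h₂.1 hxne
  set s₁ := w x₁ with hs₁
  set s₂ := w x₂ with hs₂
  set n₀ := w T.a₆ with hn₀
  have hx₁ : s₁ < 1 := hlt.trans hx₂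
  have hs₁0 : 0 < s₁ := w_x_pos_of_lt_sq hm₁
  have hs₂0 : 0 < s₂ := lt_trans hs₁0 hlt
  have hm₂ : n₀ < s₂ ^ 2 := hm₁.trans (pow_lt_pow_left₀ hlt zero_le two_ne_zero)
  have hn0 : 0 < n₀ := hprod ▸ pow_pos (mul_pos hs₁0 hs₂0) 2
  have hA : w (x₁ * y₂) ^ 2 ≤ n₀ * s₂ ^ 2 := by
    have hle := (hT.branch₀_w_y_le h₂.1 hx₂ hy₂).1
    have h1 : (s₁ * (w y₂ * s₂)) ^ 2 ≤ n₀ * s₂ ^ 2 * s₂ ^ 2 := by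
      have h2 : (s₁ * (w y₂ * s₂)) ^ 2 ≤ (s₁ * max (s₂ ^ 3) n₀) ^ 2 :=
        pow_le_pow_left' (mul_le_mul_of_nonneg_left hle zero_le) 2
      refine h2.trans ?_
      rcases le_total (s₂ ^ 3) n₀ with h3 | h3
      · rw [max_eq_right h3]
        calc (s₁ * n₀) ^ 2 = (s₁ ^ 2 * n₀) * n₀ := by ring
          _ ≤ (s₂ ^ 2 * s₂ ^ 2) * n₀ := by
              refine mul_le_mul_of_nonneg_right ?_ zero_le
              exact (mul_lt_mul'' (pow_lt_pow_left₀ hlt zero_le two_ne_zero) hm₂ zero_le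
                zero_le).le
          _ = n₀ * s₂ ^ 2 * s₂ ^ 2 := by ring
      · rw [max_eq_left h3]
        exact le_of_eq (by rw [← hprod]; ring)
    rw [map_mul]
    have h4 : (s₁ * w y₂) ^ 2 * s₂ ^ 2 ≤ n₀ * s₂ ^ 2 * s₂ ^ 2 := by
      calc (s₁ * w y₂) ^ 2 * s₂ ^ 2 = (s₁ * (w y₂ * s₂)) ^ 2 := by ring
        _ ≤ n₀ * s₂ ^ 2 * s₂ ^ 2 := h1
    exact le_of_mul_le_mul_right h4 (by positivity)
  have hB : w (x₂ * y₁) ^ 2 ≤ n₀ * s₂ ^ 2 := by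
    have hle := (hT.branch₀_w_y_le h₁.1 hx₁ hy₁).1
    have h1 : (w y₁ * s₁) ^ 2 ≤ n₀ * s₁ ^ 2 := by
      refine (pow_le_pow_left' hle 2).trans ?_
      rcases le_total (s₁ ^ 3) n₀ with h3 | h3
      · rw [max_eq_right h3]
        calc n₀ ^ 2 = n₀ * n₀ := sq n₀
          _ ≤ n₀ * s₁ ^ 2 := mul_le_mul_of_nonneg_left hm₁.le zero_le
      · rw [max_eq_left h3]
        have h5 : s₁ ^ 4 ≤ n₀ := by
          calc s₁ ^ 4 = (s₁ * s₁) ^ 2 := by ring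
            _ ≤ (s₁ * s₂) ^ 2 := pow_le_pow_left' (mul_le_mul_of_nonneg_left hlt.le zero_le) 2
            _ = n₀ := hprod
        calc (s₁ ^ 3) ^ 2 = s₁ ^ 4 * s₁ ^ 2 := by ring
          _ ≤ n₀ * s₁ ^ 2 := mul_le_mul_of_nonneg_right h5 zero_le
    rw [map_mul]
    have h2 : (s₂ * w y₁) ^ 2 * s₁ ^ 2 ≤ n₀ * s₂ ^ 2 * s₁ ^ 2 := by
      calc (s₂ * w y₁) ^ 2 * s₁ ^ 2 = (w y₁ * s₁) ^ 2 * s₂ ^ 2 := by ring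
        _ ≤ n₀ * s₁ ^ 2 * s₂ ^ 2 := mul_le_mul_of_nonneg_right h1 zero_le
        _ = n₀ * s₂ ^ 2 * s₁ ^ 2 := by ring
    exact le_of_mul_le_mul_right h2 (by positivity)
  have hR : w ((x₁ * y₂ - x₂ * y₁) ^ 2 - T.a₆ * (x₁ - x₂) ^ 2) ≤ n₀ * s₂ ^ 2 := by
    refine (Valuation.map_sub _ _ _).trans (max_le ?_ ?_)
    · rw [map_pow]; exact w_sub_sq_le hA hB
    · rw [map_mul, map_pow, hD]
  set x₃ := T.toAffine.addX x₁ x₂ (T.toAffine.slope x₁ x₂ y₁ y₂) with hx₃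
  rw [hD] at hX
  have hwx₃ : w x₃ * (s₁ * s₂) ≤ n₀ := by
    have : w x₃ * (s₁ * s₂) * s₂ ^ 2 ≤ n₀ * s₂ ^ 2 := by rw [hX]; exact hR
    exact le_of_mul_le_mul_right this (pow_pos hs₂0 2)
  have hsq : w x₃ ^ 2 ≤ n₀ := by
    have h1 : (w x₃ * (s₁ * s₂)) ^ 2 ≤ n₀ ^ 2 := pow_le_pow_left' hwx₃ 2
    have h2 : w x₃ ^ 2 * n₀ ≤ n₀ * n₀ := by
      calc w x₃ ^ 2 * n₀ = (w x₃ * (s₁ * s₂)) ^ 2 := by rw [← hprod]; ring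
        _ ≤ n₀ ^ 2 := h1
        _ = n₀ * n₀ := sq n₀
    exact le_of_mul_le_mul_right h2 hn0
  have hx₃1 : w x₃ < 1 := by
    have h1 : w x₃ * (s₁ * s₂) < 1 * (s₁ * s₂) := by
      rw [one_mul]
      refine lt_of_le_of_lt hwx₃ ?_
      rw [← hprod, sq]
      calc s₁ * s₂ * (s₁ * s₂) < s₁ * s₂ * 1 := by
            refine mul_lt_mul_of_pos_left ?_ (mul_pos hs₁0 hs₂0)
            calc s₁ * s₂ < 1 * 1 := mul_lt_mul'' hx₁ hx₂ zero_le zero_le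
              _ = 1 := one_mul _
        _ = s₁ * s₂ := mul_one _
    exact lt_of_mul_lt_mul_right h1 zero_le
  exact ⟨x₃, _, _, WeierstrassCurve.Affine.Point.add_of_X_ne hxne, hsq, hx₃1⟩

/-! ### Second branch + first branch -/

/-- **Climbing the second branch.**  On a Tate form let `P = (x₁, y₁)` be a small point on the
second branch (`|y₁ + x₁| < |x₁|`, `|a₆| < |x₁|²`) and `Q = (x₂, y₂)` a small point on the first
branch (`|y₂| < |x₂|`) with `|x₁| < |x₂|`.  Then `P + Q = (x₃, y₃)` is a small point on the second
branch with `|x₃| |x₂| = |x₁|` (on `E_q`: `φ(u₁) + φ(u₂) = φ(u₁u₂)`, `v(u₁) > v(q)/2 > v(u₂)`;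
Silverman, *ATAEC*, V.4 Lemma 4.1.2).
[cite: SilvermanATAEC1994, V.4 Lemmas 4.1.1–4.1.2 (PDF pp. 402–403)] -/
theorem add_of_branch₁_of_branch₀_of_lt (hT : IsTateForm w T) {x₁ y₁ x₂ y₂ : L}
    (h₁ : T.toAffine.Nonsingular x₁ y₁) (h₂ : T.toAffine.Nonsingular x₂ y₂)
    (hx₂ : w x₂ < 1) (hlt : w x₁ < w x₂) (hm₁ : w T.a₆ < w x₁ ^ 2)
    (hy₁ : w (y₁ + x₁) < w x₁) (hy₂ : w y₂ < w x₂) :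
    ∃ (x₃ y₃ : L) (h₃ : T.toAffine.Nonsingular x₃ y₃),
      (.some x₁ y₁ h₁ : T.toAffine.Point) + .some x₂ y₂ h₂ = .some x₃ y₃ h₃ ∧
      w x₃ * w x₂ = w x₁ ∧ w (y₃ + x₃) < w x₃ := by
  have hxne : x₁ ≠ x₂ := fun h ↦ hlt.ne (by rw [h])
  have hD : w (x₁ - x₂) = w x₂ := Valuation.map_sub_eq_of_lt_right _ hlt
  obtain ⟨hℓ, hX, hY⟩ := hT.chord_w h₁.1 h₂.1 hxne
  set s₁ := w x₁ with hs₁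
  set s₂ := w x₂ with hs₂
  set n₀ := w T.a₆ with hn₀
  have hx₁ : s₁ < 1 := hlt.trans hx₂
  have hs₁0 : 0 < s₁ := w_x_pos_of_lt_sq hm₁
  have hs₂0 : 0 < s₂ := lt_trans hs₁0 hlt
  have hwy₁ : w y₁ = s₁ := (hT.branch₁_w h₁.1 hx₁ hy₁).1
  -- slope `< 1`
  have hℓ1 : w (T.toAffine.slope x₁ x₂ y₁ y₂) < 1 := by
    rw [WeierstrassCurve.Affine.slope_of_X_ne hxne, map_div₀, hD, div_lt_one₀ hs₂0]
    exact lt_of_le_of_lt (Valuation.map_sub w y₁ y₂) (max_lt (hwy₁ ▸ hlt) hy₂)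
  -- numerator: `|x₂ y₁| = |x₁||x₂|` dominates `|x₁ y₂|`
  have hN : w (x₁ * y₂ - x₂ * y₁) = s₁ * s₂ := by
    have h1 : w (x₂ * y₁) = s₁ * s₂ := by rw [map_mul, hwy₁, mul_comm]
    have h2 : w (x₁ * y₂) < w (x₂ * y₁) := by
      rw [h1, map_mul]
      exact mul_lt_mul_of_pos_left hy₂ hs₁0
    rw [Valuation.map_sub_eq_of_lt_right _ h2, h1]
  have hR : w ((x₁ * y₂ - x₂ * y₁) ^ 2 - T.a₆ * (x₁ - x₂) ^ 2) = (s₁ * s₂) ^ 2 := by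
    have h1 : w ((x₁ * y₂ - x₂ * y₁) ^ 2) = (s₁ * s₂) ^ 2 := by rw [map_pow, hN]
    rw [Valuation.map_sub_eq_of_lt_left _ (by
      rw [h1, map_mul, map_pow, hD]
      calc n₀ * s₂ ^ 2 < s₁ ^ 2 * s₂ ^ 2 := mul_lt_mul_of_pos_right hm₁ (pow_pos hs₂0 2)
        _ = (s₁ * s₂) ^ 2 := by ring), h1]
  set x₃ := T.toAffine.addX x₁ x₂ (T.toAffine.slope x₁ x₂ y₁ y₂) with hx₃
  set y₃ := T.toAffine.addY x₁ x₂ y₁ (T.toAffine.slope x₁ x₂ y₁ y₂) with hy₃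
  rw [hR, hD] at hX
  have hwx₃ : w x₃ * s₂ = s₁ := by
    have hK : s₁ * s₂ * s₂ ≠ 0 := by positivity
    apply mul_right_cancel₀ hK
    calc w x₃ * s₂ * (s₁ * s₂ * s₂) = w x₃ * (s₁ * s₂) * s₂ ^ 2 := by ring
      _ = (s₁ * s₂) ^ 2 := hX
      _ = s₁ * (s₁ * s₂ * s₂) := by ring
  have hx₃0 : 0 < w x₃ := by
    refine lt_of_le_of_ne zero_le fun h0 ↦ ?_
    rw [← h0, zero_mul] at hwx₃
    exact hs₁0.ne hwx₃
  have hNlt : w (x₁ * y₂ - x₂ * y₁) < w x₃ * s₂ := by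
    rw [hN, hwx₃]
    calc s₁ * s₂ < s₁ * 1 := mul_lt_mul_of_pos_left hx₂ hs₁0
      _ = s₁ := mul_one _
  have hLlt : w (T.toAffine.slope x₁ x₂ y₁ y₂ * x₃ * (x₁ - x₂)) < w x₃ * s₂ := by
    rw [map_mul, map_mul, hD]
    calc w (T.toAffine.slope x₁ x₂ y₁ y₂) * w x₃ * s₂ < 1 * w x₃ * s₂ :=
          mul_lt_mul_of_pos_right (mul_lt_mul_of_pos_right hℓ1 hx₃0) hs₂0
      _ = w x₃ * s₂ := by rw [one_mul]
  have hwyx : w (y₃ + x₃) < w x₃ := by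
    have h1 : w (y₃ + x₃) * s₂ < w x₃ * s₂ := by
      rw [hD] at hY
      rw [hY]
      exact lt_of_le_of_lt (Valuation.map_add _ _ _) (max_lt hLlt hNlt)
    exact lt_of_mul_lt_mul_right h1 zero_le
  exact ⟨x₃, y₃, _, WeierstrassCurve.Affine.Point.add_of_X_ne hxne, hwx₃, hwyx⟩

/-- **Second branch + first branch at the same level lands in `E₀`.**  `P = (x₁, y₁)` small on
the second branch, `Q = (x₂, y₂)` small on the first branch, `|x₁| = |x₂|`, `|a₆| < |x₁|²`,
`x₁ ≠ x₂`: `P + Q` is not small (on `E_q`: `v(u₁) + v(u₂) = v(q)`).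
[cite: SilvermanATAEC1994, V.4 Lemma 4.1.2 (PDF p. 403)] -/
theorem not_isSmall_add_of_branch₁_of_branch₀ (hT : IsTateForm w T) {x₁ y₁ x₂ y₂ : L}
    (h₁ : T.toAffine.Nonsingular x₁ y₁) (h₂ : T.toAffine.Nonsingular x₂ y₂)
    (hx₂ : w x₂ < 1) (heq : w x₁ = w x₂) (hxne : x₁ ≠ x₂) (hm₁ : w T.a₆ < w x₁ ^ 2)
    (hy₁ : w (y₁ + x₁) < w x₁) (hy₂ : w y₂ < w x₂) :
    ¬ IsSmall w ((.some x₁ y₁ h₁ : T.toAffine.Point) + .some x₂ y₂ h₂) := by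
  obtain ⟨hℓ, hX, -⟩ := hT.chord_w h₁.1 h₂.1 hxne
  set t := w x₂ with ht
  set n₀ := w T.a₆ with hn₀
  have ht0 : 0 < t := by rw [← heq]; exact w_x_pos_of_lt_sq hm₁
  have hwy₁ : w y₁ = t := heq ▸ (hT.branch₁_w h₁.1 (heq ▸ hx₂) hy₁).1
  have hN : w (x₁ * y₂ - x₂ * y₁) = t ^ 2 := by
    have h1 : w (x₂ * y₁) = t ^ 2 := by rw [map_mul, hwy₁, sq]
    have h2 : w (x₁ * y₂) < w (x₂ * y₁) := by
      rw [h1, map_mul, heq, sq]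
      exact mul_lt_mul_of_pos_left hy₂ ht0
    rw [Valuation.map_sub_eq_of_lt_right _ h2, h1]
  have hD : w (x₁ - x₂) ≤ t := (Valuation.map_sub w x₁ x₂).trans (max_le heq.le le_rfl)
  have hD0 : 0 < w (x₁ - x₂) := (Valuation.pos_iff _).mpr (sub_ne_zero.mpr hxne)
  have hR : w ((x₁ * y₂ - x₂ * y₁) ^ 2 - T.a₆ * (x₁ - x₂) ^ 2) = (t ^ 2) ^ 2 := by
    have h1 : w ((x₁ * y₂ - x₂ * y₁) ^ 2) = (t ^ 2) ^ 2 := by rw [map_pow, hN]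
    rw [Valuation.map_sub_eq_of_lt_left _ (by
      rw [h1, map_mul, map_pow]
      calc n₀ * w (x₁ - x₂) ^ 2 ≤ n₀ * t ^ 2 :=
            mul_le_mul_of_nonneg_left (pow_le_pow_left' hD 2) zero_le
        _ < t ^ 2 * t ^ 2 := mul_lt_mul_of_pos_right (heq ▸ hm₁) (pow_pos ht0 2)
        _ = (t ^ 2) ^ 2 := by ring), h1]
  rw [WeierstrassCurve.Affine.Point.add_of_X_ne hxne, isSmall_some, not_lt]
  set x₃ := T.toAffine.addX x₁ x₂ (T.toAffine.slope x₁ x₂ y₁ y₂) with hx₃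
  rw [hR, heq] at hX
  -- `|x₃| t² |x₁ - x₂|² = t⁴` with `|x₁ - x₂| ≤ t`
  by_contra hlt
  rw [not_le] at hlt
  have : w x₃ * (t * t) * w (x₁ - x₂) ^ 2 < (t ^ 2) ^ 2 := by
    calc w x₃ * (t * t) * w (x₁ - x₂) ^ 2 < 1 * (t * t) * w (x₁ - x₂) ^ 2 := by
          exact mul_lt_mul_of_pos_right (mul_lt_mul_of_pos_right hlt (mul_pos ht0 ht0))
            (pow_pos hD0 2)
      _ ≤ 1 * (t * t) * t ^ 2 := mul_le_mul_of_nonneg_left (pow_le_pow_left' hD 2) zero_le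
      _ = (t ^ 2) ^ 2 := by ring
  exact this.ne hX

/-! ### Doubling on the first branch -/

omit [DecidableEq L] in
/-- `|x₁³ - a₄x₁ - 2a₆| ≤ max(|x₁|³, |a₆|)` (`|x₁| < 1`), with equality `= |x₁|³` when
`|a₆| < |x₁|³`. [folklore] -/
theorem IsTateForm.w_tangentNum (hT : IsTateForm w T) {x₁ : L} (hx₁ : w x₁ < 1) :
    w (x₁ ^ 3 - T.a₄ * x₁ - 2 * T.a₆) ≤ max (w x₁ ^ 3) (w T.a₆) ∧
      (w T.a₆ < w x₁ ^ 3 → w (x₁ ^ 3 - T.a₄ * x₁ - 2 * T.a₆) = w x₁ ^ 3) := by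
  have h2 : w (2 : L) ≤ 1 := by exact_mod_cast FormalGroupChart.val_natCast_le_one w 2
  have hrest : w (T.a₄ * x₁ + 2 * T.a₆) ≤ w T.a₆ := by
    refine (Valuation.map_add _ _ _).trans (max_le ?_ ?_)
    · rw [map_mul]
      calc w T.a₄ * w x₁ ≤ w T.a₆ * 1 := mul_le_mul' hT.w_a₄_le hx₁.le
        _ = w T.a₆ := mul_one _
    · rw [map_mul]
      calc w 2 * w T.a₆ ≤ 1 * w T.a₆ := mul_le_mul_of_nonneg_right h2 zero_le
        _ = w T.a₆ := one_mul _
  have he : x₁ ^ 3 - T.a₄ * x₁ - 2 * T.a₆ = x₁ ^ 3 - (T.a₄ * x₁ + 2 * T.a₆) := by ring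
  rw [he]
  refine ⟨(Valuation.map_sub _ _ _).trans (max_le ?_ (hrest.trans (le_max_right _ _))), fun h3 ↦ ?_⟩
  · rw [map_pow]; exact le_max_left _ _
  · rw [Valuation.map_sub_eq_of_lt_left _ (by rw [map_pow]; exact lt_of_le_of_lt hrest h3), map_pow]

/-- The tangent slope at a first-branch small point has `|λ| < 1` (`|a₆| < |x₁|²`). [folklore] -/
theorem IsTateForm.w_tangentSlope_lt_one (hT : IsTateForm w T) {x₁ y₁ : L}
    (h₁ : T.toAffine.Equation x₁ y₁) (hx₁ : w x₁ < 1) (hm : w T.a₆ < w x₁ ^ 2)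
    (hy₁ : w y₁ < w x₁) : w (T.toAffine.slope x₁ x₁ y₁ y₁) < 1 := by
  obtain ⟨-, hD, hℓ, -, -⟩ := hT.tangent_w h₁ hy₁
  have hx0 : 0 < w x₁ := lt_of_le_of_lt zero_le hy₁
  have h3 : w (3 : L) ≤ 1 := by exact_mod_cast FormalGroupChart.val_natCast_le_one w 3
  have hnum : w (3 * x₁ ^ 2 + T.a₄ - y₁) < w x₁ := by
    refine Valuation.map_sub_lt _ (Valuation.map_add_lt _ ?_ ?_) hy₁
    · rw [map_mul, map_pow]
      calc w 3 * w x₁ ^ 2 ≤ 1 * w x₁ ^ 2 := mul_le_mul_of_nonneg_right h3 zero_le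
        _ = w x₁ * w x₁ := by ring
        _ < 1 * w x₁ := mul_lt_mul_of_pos_right hx₁ hx0
        _ = w x₁ := one_mul _
    · calc w T.a₄ ≤ w T.a₆ := hT.w_a₄_le
        _ < w x₁ ^ 2 := hm
        _ = w x₁ * w x₁ := sq _
        _ < 1 * w x₁ := mul_lt_mul_of_pos_right hx₁ hx0
        _ = w x₁ := one_mul _
  have hD0 : (0 : ℝ≥0) < w (2 * y₁ + x₁) := by rw [hD]; exact hx0
  have key : w (T.toAffine.slope x₁ x₁ y₁ y₁) * w (2 * y₁ + x₁) < 1 * w (2 * y₁ + x₁) := by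
    rw [← map_mul, hℓ, one_mul, hD]; exact hnum
  exact lt_of_mul_lt_mul_right key zero_le

/-- **Doubling above the middle.**  `P = (x₁, y₁)` small on the first branch with `|a₆| < |x₁|⁴`:
`2P = (x₃, y₃)` is small on the first branch at level `|x₃| = |x₁|²` (on `E_q`: `2φ(u) = φ(u²)`,
`|u²| > |q|^{1/2}`). [cite: SilvermanATAEC1994, V.4 Lemmas 4.1.1–4.1.2 (PDF pp. 402–403)] -/
theorem two_nsmul_of_branch₀_of_lt_pow_four (hT : IsTateForm w T) {x₁ y₁ : L}
    (h₁ : T.toAffine.Nonsingular x₁ y₁) (hx₁ : w x₁ < 1) (hy₁ : w y₁ < w x₁)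
    (h4 : w T.a₆ < w x₁ ^ 4) :
    ∃ (x₃ y₃ : L) (h₃ : T.toAffine.Nonsingular x₃ y₃),
      (.some x₁ y₁ h₁ : T.toAffine.Point) + .some x₁ y₁ h₁ = .some x₃ y₃ h₃ ∧
      w x₃ = w x₁ ^ 2 ∧ w y₃ < w x₃ := by
  obtain ⟨hneg, hD, hℓ, hX, hY⟩ := hT.tangent_w h₁.1 hy₁
  set s := w x₁ with hs
  set n₀ := w T.a₆ with hn₀
  have hs0 : 0 < s := lt_of_le_of_lt zero_le hy₁
  have h43 : s ^ 4 ≤ s ^ 3 := by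
    calc s ^ 4 = s ^ 3 * s := by ring
      _ ≤ s ^ 3 * 1 := mul_le_mul_of_nonneg_left hx₁.le zero_le
      _ = s ^ 3 := mul_one _
  have h32 : s ^ 3 ≤ s ^ 2 := by
    calc s ^ 3 = s ^ 2 * s := by ring
      _ ≤ s ^ 2 * 1 := mul_le_mul_of_nonneg_left hx₁.le zero_le
      _ = s ^ 2 := mul_one _
  have h3 : n₀ < s ^ 3 := lt_of_lt_of_le h4 h43
  have hm : n₀ < s ^ 2 := lt_of_lt_of_le h3 h32
  have hN : w (x₁ ^ 3 - T.a₄ * x₁ - 2 * T.a₆) = s ^ 3 := (hT.w_tangentNum hx₁).2 h3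
  have hR : w ((x₁ ^ 3 - T.a₄ * x₁ - 2 * T.a₆) ^ 2 - T.a₆ * (2 * y₁ + x₁) ^ 2) = (s ^ 3) ^ 2 := by
    have h1 : w ((x₁ ^ 3 - T.a₄ * x₁ - 2 * T.a₆) ^ 2) = (s ^ 3) ^ 2 := by rw [map_pow, hN]
    rw [Valuation.map_sub_eq_of_lt_left _ (by
      rw [h1, map_mul, map_pow, hD]
      calc n₀ * s ^ 2 < s ^ 4 * s ^ 2 := mul_lt_mul_of_pos_right h4 (pow_pos hs0 2)
        _ = (s ^ 3) ^ 2 := by ring), h1]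
  set x₃ := T.toAffine.addX x₁ x₁ (T.toAffine.slope x₁ x₁ y₁ y₁) with hx₃
  set y₃ := T.toAffine.addY x₁ x₁ y₁ (T.toAffine.slope x₁ x₁ y₁ y₁) with hy₃
  rw [hR] at hX
  have hwx₃ : w x₃ = s ^ 2 := by
    have hK : s ^ 2 * s ^ 2 ≠ 0 := by positivity
    apply mul_right_cancel₀ hK
    calc w x₃ * (s ^ 2 * s ^ 2) = w x₃ * s ^ 2 * s ^ 2 := by ring
      _ = (s ^ 3) ^ 2 := hX
      _ = s ^ 2 * (s ^ 2 * s ^ 2) := by ring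
  have hℓ1 := hT.w_tangentSlope_lt_one h₁.1 hx₁ hm hy₁
  have hwyx : w (y₃ + x₃) = w x₃ := by
    have h1 : w (-(T.toAffine.slope x₁ x₁ y₁ y₁ * x₃ * (2 * y₁ + x₁))) <
        w (x₁ ^ 3 - T.a₄ * x₁ - 2 * T.a₆) := by
      rw [Valuation.map_neg, map_mul, map_mul, hwx₃, hD, hN]
      calc w (T.toAffine.slope x₁ x₁ y₁ y₁) * s ^ 2 * s < 1 * s ^ 2 * s :=
            mul_lt_mul_of_pos_right (mul_lt_mul_of_pos_right hℓ1 (pow_pos hs0 2)) hs0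
        _ = s ^ 3 := by ring
    rw [Valuation.map_add_eq_of_lt_right _ h1, hN] at hY
    apply mul_right_cancel₀ hs0.ne'
    rw [hY, hwx₃]; ring
  have hx₃1 : w x₃ < 1 := by
    rw [hwx₃, sq]
    calc s * s < 1 * 1 := mul_lt_mul'' hx₁ hx₁ zero_le zero_le
      _ = 1 := mul_one _
  have hmid₃ : w T.a₆ < w x₃ ^ 2 := by
    rw [hwx₃]
    calc n₀ < s ^ 4 := h4
      _ = (s ^ 2) ^ 2 := by ring
  refine ⟨x₃, y₃, _, WeierstrassCurve.Affine.Point.add_self_of_Y_ne hneg, hwx₃, ?_⟩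
  rcases branch hT (WeierstrassCurve.Affine.equation_add h₁.1 h₁.1 fun hxy ↦ hneg hxy.2) hx₃1
    hmid₃ with hb | hb
  · exact hb.1
  · exact absurd hwyx (ne_of_lt hb.1)

/-- **Doubling across the middle.**  `P = (x₁, y₁)` small on the first branch, `|a₆| < |x₁|²` but
`|x₁|⁴ < |a₆|`: `2P = (x₃, y₃)` is small on the second branch with `|x₃| |x₁|² = |a₆|`.
[cite: SilvermanATAEC1994, V.4 Lemmas 4.1.1–4.1.3 (PDF pp. 402–404)] -/
theorem two_nsmul_of_branch₀_of_pow_four_lt (hT : IsTateForm w T) {x₁ y₁ : L}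
    (h₁ : T.toAffine.Nonsingular x₁ y₁) (hx₁ : w x₁ < 1) (hm : w T.a₆ < w x₁ ^ 2)
    (hy₁ : w y₁ < w x₁) (h4 : w x₁ ^ 4 < w T.a₆) :
    ∃ (x₃ y₃ : L) (h₃ : T.toAffine.Nonsingular x₃ y₃),
      (.some x₁ y₁ h₁ : T.toAffine.Point) + .some x₁ y₁ h₁ = .some x₃ y₃ h₃ ∧
      w x₃ * w x₁ ^ 2 = w T.a₆ ∧ w (y₃ + x₃) < w x₃ := by
  obtain ⟨hneg, hD, hℓ, hX, hY⟩ := hT.tangent_w h₁.1 hy₁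
  set s := w x₁ with hs
  set n₀ := w T.a₆ with hn₀
  have hs0 : 0 < s := lt_of_le_of_lt zero_le hy₁
  have hn0 : 0 < n₀ := lt_of_le_of_lt zero_le h4
  -- `|N|² < |a₆| |x₁|²`
  have hN2 : w (x₁ ^ 3 - T.a₄ * x₁ - 2 * T.a₆) ^ 2 < n₀ * s ^ 2 := by
    refine lt_of_le_of_lt (pow_le_pow_left' (hT.w_tangentNum hx₁).1 2) ?_
    rcases le_total (s ^ 3) n₀ with h3 | h3
    · rw [max_eq_right h3, sq]
      exact mul_lt_mul_of_pos_left hm hn0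
    · rw [max_eq_left h3]
      calc (s ^ 3) ^ 2 = s ^ 4 * s ^ 2 := by ring
        _ < n₀ * s ^ 2 := mul_lt_mul_of_pos_right h4 (pow_pos hs0 2)
  have hR : w ((x₁ ^ 3 - T.a₄ * x₁ - 2 * T.a₆) ^ 2 - T.a₆ * (2 * y₁ + x₁) ^ 2) = n₀ * s ^ 2 := by
    have h2 : w (T.a₆ * (2 * y₁ + x₁) ^ 2) = n₀ * s ^ 2 := by rw [map_mul, map_pow, hD]
    rw [Valuation.map_sub_eq_of_lt_right _ (by rw [h2, map_pow]; exact hN2), h2]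
  set x₃ := T.toAffine.addX x₁ x₁ (T.toAffine.slope x₁ x₁ y₁ y₁) with hx₃
  set y₃ := T.toAffine.addY x₁ x₁ y₁ (T.toAffine.slope x₁ x₁ y₁ y₁) with hy₃
  rw [hR] at hX
  have hwx₃ : w x₃ * s ^ 2 = n₀ := by
    apply mul_right_cancel₀ (pow_pos hs0 2).ne'
    exact hX
  have hx₃0 : 0 < w x₃ := by
    refine lt_of_le_of_ne zero_le fun h0 ↦ ?_
    rw [← h0, zero_mul] at hwx₃
    exact hn0.ne hwx₃
  have hℓ1 := hT.w_tangentSlope_lt_one h₁.1 hx₁ hm hy₁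
  -- both terms of `(y₃ + x₃)(2y₁ + x₁)` are `< |x₃||x₁|`
  have hNlt : w (x₁ ^ 3 - T.a₄ * x₁ - 2 * T.a₆) < w x₃ * s := by
    have h1 : w (x₁ ^ 3 - T.a₄ * x₁ - 2 * T.a₆) ^ 2 * s ^ 2 < (w x₃ * s) ^ 2 * s ^ 2 := by
      calc w (x₁ ^ 3 - T.a₄ * x₁ - 2 * T.a₆) ^ 2 * s ^ 2 < n₀ * s ^ 2 * s ^ 2 :=
            mul_lt_mul_of_pos_right hN2 (pow_pos hs0 2)
        _ = n₀ * s ^ 4 := by ring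
        _ ≤ n₀ * n₀ := mul_le_mul_of_nonneg_left h4.le zero_le
        _ = (w x₃ * s) ^ 2 * s ^ 2 := by rw [← hwx₃]; ring
    exact lt_of_pow_lt_pow_left₀ 2 zero_le (lt_of_mul_lt_mul_right h1 zero_le)
  have hLlt : w (-(T.toAffine.slope x₁ x₁ y₁ y₁ * x₃ * (2 * y₁ + x₁))) < w x₃ * s := by
    rw [Valuation.map_neg, map_mul, map_mul, hD]
    calc w (T.toAffine.slope x₁ x₁ y₁ y₁) * w x₃ * s < 1 * w x₃ * s :=
          mul_lt_mul_of_pos_right (mul_lt_mul_of_pos_right hℓ1 hx₃0) hs0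
      _ = w x₃ * s := by rw [one_mul]
  have hwyx : w (y₃ + x₃) < w x₃ := by
    have h1 : w (y₃ + x₃) * s < w x₃ * s := by
      rw [hY]
      exact lt_of_le_of_lt (Valuation.map_add _ _ _) (max_lt hLlt hNlt)
    exact lt_of_mul_lt_mul_right h1 zero_le
  exact ⟨x₃, y₃, _, WeierstrassCurve.Affine.Point.add_self_of_Y_ne hneg, hwx₃, hwyx⟩

/-- **Doubling onto the middle.**  `P = (x₁, y₁)` small on the first branch, `|a₆| < |x₁|²`,
`|x₁|⁴ = |a₆|`: `2P = (x₃, y₃)` is small with `|x₃|² ≤ |a₆|`.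
[cite: SilvermanATAEC1994, V.4 Lemma 4.1.4 (PDF p. 405)] -/
theorem two_nsmul_of_branch₀_of_pow_four_eq (hT : IsTateForm w T) {x₁ y₁ : L}
    (h₁ : T.toAffine.Nonsingular x₁ y₁) (hx₁ : w x₁ < 1) (hm : w T.a₆ < w x₁ ^ 2)
    (hy₁ : w y₁ < w x₁) (h4 : w x₁ ^ 4 = w T.a₆) :
    ∃ (x₃ y₃ : L) (h₃ : T.toAffine.Nonsingular x₃ y₃),
      (.some x₁ y₁ h₁ : T.toAffine.Point) + .some x₁ y₁ h₁ = .some x₃ y₃ h₃ ∧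
      w x₃ ^ 2 ≤ w T.a₆ ∧ w x₃ < 1 := by
  obtain ⟨hneg, hD, hℓ, hX, -⟩ := hT.tangent_w h₁.1 hy₁
  set s := w x₁ with hs
  set n₀ := w T.a₆ with hn₀
  have hs0 : 0 < s := lt_of_le_of_lt zero_le hy₁
  have hN2 : w (x₁ ^ 3 - T.a₄ * x₁ - 2 * T.a₆) ^ 2 ≤ n₀ * s ^ 2 := by
    refine (pow_le_pow_left' (hT.w_tangentNum hx₁).1 2).trans ?_
    rcases le_total (s ^ 3) n₀ with h3 | h3
    · rw [max_eq_right h3, sq]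
      exact mul_le_mul_of_nonneg_left hm.le zero_le
    · rw [max_eq_left h3]
      exact le_of_eq (by rw [← h4]; ring)
  have hR : w ((x₁ ^ 3 - T.a₄ * x₁ - 2 * T.a₆) ^ 2 - T.a₆ * (2 * y₁ + x₁) ^ 2) ≤ n₀ * s ^ 2 := by
    refine (Valuation.map_sub _ _ _).trans (max_le ?_ ?_)
    · rw [map_pow]; exact hN2
    · rw [map_mul, map_pow, hD]
  set x₃ := T.toAffine.addX x₁ x₁ (T.toAffine.slope x₁ x₁ y₁ y₁) with hx₃
  have hwx₃ : w x₃ ≤ s ^ 2 := by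
    have h1 : w x₃ * s ^ 2 * s ^ 2 ≤ s ^ 2 * s ^ 2 * s ^ 2 := by
      rw [hX]
      calc w ((x₁ ^ 3 - T.a₄ * x₁ - 2 * T.a₆) ^ 2 - T.a₆ * (2 * y₁ + x₁) ^ 2) ≤ n₀ * s ^ 2 := hR
        _ = s ^ 2 * s ^ 2 * s ^ 2 := by rw [← h4]; ring
    exact le_of_mul_le_mul_right (le_of_mul_le_mul_right h1 (pow_pos hs0 2)) (pow_pos hs0 2)
  refine ⟨x₃, _, _, WeierstrassCurve.Affine.Point.add_self_of_Y_ne hneg, ?_, ?_⟩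
  · calc w x₃ ^ 2 ≤ (s ^ 2) ^ 2 := pow_le_pow_left' hwx₃ 2
      _ = n₀ := by rw [← h4]; ring
  · refine lt_of_le_of_lt hwx₃ ?_
    rw [sq]
    calc s * s < 1 * 1 := mul_lt_mul'' hx₁ hx₁ zero_le zero_le
      _ = 1 := mul_one _

/-! ### Translating a small point by the kernel of reduction -/

omit [DecidableEq L] in
/-- **The exact identity behind `x(P + Q) - x(P)`.**  For affine `(x₁, y₁)`, `(x₂, y₂)` on a
Tate form and `ℓ (x₁ - x₂) = y₁ - y₂`:
`(x₃ - x₁) · x₁ · (x₁ - x₂)² · x₂ = x₂ · B` with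
`B = x₂y₁² - x₁²y₂ + a₄x₁² - x₁⁴ + 2x₁a₆ - 2x₁y₁y₂ + 2x₁³x₂ - a₆x₂`; when `Q = (x₂, y₂) ∈ E₁`
and `P = (x₁, y₁)` is small, `-x₁²y₂` is the leading term of `B`. [folklore] -/
theorem IsTateForm.sub_X_mul_eq (hT : IsTateForm w T) {x₁ y₁ x₂ y₂ ℓ : L}
    (h₁ : T.toAffine.Equation x₁ y₁) (h₂ : T.toAffine.Equation x₂ y₂)
    (hℓ : ℓ * (x₁ - x₂) = y₁ - y₂) :
    (T.toAffine.addX x₁ x₂ ℓ - x₁) * x₁ * (x₁ - x₂) ^ 2 * x₂ =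
      x₂ * (x₂ * y₁ ^ 2 + T.a₄ * x₁ ^ 2 - x₁ ^ 4 + 2 * x₁ * T.a₆ - 2 * x₁ * y₁ * y₂ +
        2 * x₁ ^ 3 * x₂ - T.a₆ * x₂ - x₁ ^ 2 * y₂) := by
  rw [hT.equation_iff] at h₁ h₂
  rw [hT.addX]
  linear_combination (x₁ * x₂ * ((y₁ - y₂) + ℓ * (x₁ - x₂) + (x₁ - x₂))) * hℓ +
    (x₂ * (x₁ - x₂)) * h₁ + (x₁ * x₂) * h₂

/-- **Translation by `E₁` moves `x` by the factor `1 + O(z)`.**  On a Tate form let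
`P = (x₁, y₁)` be a small point on the first branch (`|y₁| < |x₁| < 1`, `|a₆| < |x₁|²`) and
`Q = (x₂, y₂)` a point of the kernel of reduction (`|x₂| > 1`), with parameter `z = -x₂/y₂`.
Then `P + Q = (x₃, y₃)` with `|x₃ - x₁| = |x₁| · |z|` (and so `|x₃| = |x₁|`): on `E_q`,
`Q = φ(u₀)` with `|u₀ - 1| = |z|` and `x(φ(u u₀)) - x(φ(u)) = u(u₀ - 1)(1 + ⋯)`.  This is the
estimate that makes `x(P)` a Kummer-type witness for the peu ramifié criterion at a
multiplicative prime.
[cite: SilvermanATAEC1994, V.3 Thm. 3.1(c) and V.4 Lemma 4.1.1 (PDF pp. 395, 402)] -/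
theorem sub_X_of_branch₀_of_one_lt (hT : IsTateForm w T) {x₁ y₁ x₂ y₂ : L}
    (h₁ : T.toAffine.Nonsingular x₁ y₁) (h₂ : T.toAffine.Nonsingular x₂ y₂)
    (hx₁ : w x₁ < 1) (hm : w T.a₆ < w x₁ ^ 2) (hy₁ : w y₁ < w x₁) (hx₂ : 1 < w x₂) :
    ∃ (x₃ y₃ : L) (h₃ : T.toAffine.Nonsingular x₃ y₃),
      (.some x₁ y₁ h₁ : T.toAffine.Point) + .some x₂ y₂ h₂ = .some x₃ y₃ h₃ ∧
      w (x₃ - x₁) = w x₁ * w (-x₂ / y₂) ∧ w x₃ = w x₁ := by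
  haveI := hT.isIntegral
  obtain ⟨hy₂0, hZ1, hXZ, hYZ, -, hZ0⟩ := FormalGroupChart.val_zw (V := T) h₂.1 hx₂
  set Z := w (-x₂ / y₂) with hZ
  set s := w x₁ with hs
  set n₀ := w T.a₆ with hn₀
  set X₂ := w x₂ with hX₂
  have hs0 : 0 < s := lt_of_le_of_lt zero_le hy₁
  have hX0 : 0 < X₂ := lt_trans zero_lt_one hx₂
  have hlt : s < X₂ := hx₁.trans hx₂
  have hxne : x₁ ≠ x₂ := fun h ↦ hlt.ne (by rw [hs, hX₂, h])
  have hx₂0 : x₂ ≠ 0 := fun h ↦ by rw [hX₂, h, map_zero] at hX0; exact lt_irrefl _ hX0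
  have hD : w (x₁ - x₂) = X₂ := Valuation.map_sub_eq_of_lt_right _ hlt
  have hYX : w y₂ * Z = X₂ := by
    have h1 : w y₂ * Z * Z ^ 2 = X₂ * Z ^ 2 := by
      calc w y₂ * Z * Z ^ 2 = w y₂ * Z ^ 3 := by ring
        _ = 1 := hYZ
        _ = X₂ * Z ^ 2 := hXZ.symm
    exact mul_right_cancel₀ (pow_pos hZ0 2).ne' h1
  have hn1 : n₀ < 1 := hT.w_a₆_lt
  have h2 : w (2 : L) ≤ 1 := by exact_mod_cast FormalGroupChart.val_natCast_le_one w 2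
  -- the leading term
  have hmain : w (x₁ ^ 2 * y₂) = s ^ 2 * w y₂ := by rw [map_mul, map_pow]
  -- each minor term `t` has `|t| · Z < s² X₂ = |x₁² y₂| · Z`
  have hkey : ∀ t : L, w t * Z < s ^ 2 * X₂ → w t < w (x₁ ^ 2 * y₂) := fun t ht ↦ by
    rw [hmain]
    refine lt_of_mul_lt_mul_right ?_ (zero_le : (0 : ℝ≥0) ≤ Z)
    calc w t * Z < s ^ 2 * X₂ := ht
      _ = s ^ 2 * w y₂ * Z := by rw [← hYX]; ring
  have hy₁s : w y₁ < s := hy₁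
  have t1 : w (x₂ * y₁ ^ 2) < w (x₁ ^ 2 * y₂) := hkey _ (by
    rw [map_mul, map_pow]
    calc X₂ * w y₁ ^ 2 * Z ≤ X₂ * w y₁ ^ 2 * 1 := mul_le_mul_of_nonneg_left hZ1.le zero_le
      _ = w y₁ ^ 2 * X₂ := by ring
      _ < s ^ 2 * X₂ := mul_lt_mul_of_pos_right (pow_lt_pow_left₀ hy₁s zero_le two_ne_zero) hX0)
  have t2 : w (T.a₄ * x₁ ^ 2) < w (x₁ ^ 2 * y₂) := hkey _ (by
    rw [map_mul, map_pow]
    calc w T.a₄ * s ^ 2 * Z ≤ 1 * s ^ 2 * 1 :=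
          mul_le_mul' (mul_le_mul_of_nonneg_right (hT.w_a₄_le.trans hn1.le) zero_le) hZ1.le
      _ = s ^ 2 * 1 := by ring
      _ < s ^ 2 * X₂ := mul_lt_mul_of_pos_left hx₂ (pow_pos hs0 2))
  have t3 : w (x₁ ^ 4) < w (x₁ ^ 2 * y₂) := hkey _ (by
    rw [map_pow]
    calc s ^ 4 * Z ≤ s ^ 4 * 1 := mul_le_mul_of_nonneg_left hZ1.le zero_le
      _ = s ^ 2 * (s * s) := by ring
      _ < s ^ 2 * X₂ := by
          refine mul_lt_mul_of_pos_left ?_ (pow_pos hs0 2)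
          calc s * s < 1 * 1 := mul_lt_mul'' hx₁ hx₁ zero_le zero_le
            _ = 1 := mul_one _
            _ < X₂ := hx₂)
  have t4 : w (2 * x₁ * T.a₆) < w (x₁ ^ 2 * y₂) := hkey _ (by
    rw [map_mul, map_mul]
    calc w 2 * s * n₀ * Z ≤ 1 * s * n₀ * 1 :=
          mul_le_mul' (mul_le_mul_of_nonneg_right (mul_le_mul_of_nonneg_right h2 zero_le)
            zero_le) hZ1.le
      _ = s * n₀ := by ring
      _ < s * s ^ 2 := mul_lt_mul_of_pos_left hm hs0
      _ = s ^ 2 * s := by ring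
      _ < s ^ 2 * X₂ := mul_lt_mul_of_pos_left hlt (pow_pos hs0 2))
  have t5 : w (2 * x₁ * y₁ * y₂) < w (x₁ ^ 2 * y₂) := hkey _ (by
    rw [map_mul, map_mul, map_mul]
    calc w 2 * s * w y₁ * w y₂ * Z = w 2 * s * w y₁ * (w y₂ * Z) := by ring
      _ = w 2 * s * w y₁ * X₂ := by rw [hYX]
      _ ≤ 1 * s * w y₁ * X₂ := by
          refine mul_le_mul_of_nonneg_right (mul_le_mul_of_nonneg_right
            (mul_le_mul_of_nonneg_right h2 zero_le) zero_le) zero_le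
      _ = w y₁ * (s * X₂) := by ring
      _ < s * (s * X₂) := mul_lt_mul_of_pos_right hy₁s (mul_pos hs0 hX0)
      _ = s ^ 2 * X₂ := by ring)
  have t6 : w (2 * x₁ ^ 3 * x₂) < w (x₁ ^ 2 * y₂) := hkey _ (by
    rw [map_mul, map_mul, map_pow]
    calc w 2 * s ^ 3 * X₂ * Z ≤ 1 * s ^ 3 * X₂ * 1 :=
          mul_le_mul' (mul_le_mul_of_nonneg_right (mul_le_mul_of_nonneg_right h2 zero_le)
            zero_le) hZ1.le
      _ = s ^ 2 * X₂ * s := by ring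
      _ < s ^ 2 * X₂ * 1 := mul_lt_mul_of_pos_left hx₁ (mul_pos (pow_pos hs0 2) hX0)
      _ = s ^ 2 * X₂ := mul_one _)
  have t7 : w (T.a₆ * x₂) < w (x₁ ^ 2 * y₂) := hkey _ (by
    rw [map_mul]
    calc n₀ * X₂ * Z ≤ n₀ * X₂ * 1 := mul_le_mul_of_nonneg_left hZ1.le zero_le
      _ = n₀ * X₂ := mul_one _
      _ < s ^ 2 * X₂ := mul_lt_mul_of_pos_right hm hX0)
  have hB : w (x₂ * y₁ ^ 2 + T.a₄ * x₁ ^ 2 - x₁ ^ 4 + 2 * x₁ * T.a₆ - 2 * x₁ * y₁ * y₂ +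
      2 * x₁ ^ 3 * x₂ - T.a₆ * x₂ - x₁ ^ 2 * y₂) = s ^ 2 * w y₂ := by
    rw [← hmain]
    refine Valuation.map_sub_eq_of_lt_right _ ?_
    exact Valuation.map_sub_lt _ (Valuation.map_add_lt _ (Valuation.map_sub_lt _
      (Valuation.map_add_lt _ (Valuation.map_sub_lt _ (Valuation.map_add_lt _ t1 t2) t3) t4)
      t5) t6) t7
  -- the identity, valued
  obtain ⟨hℓ, -, -⟩ := hT.chord_w h₁.1 h₂.1 hxne
  have hid := congrArg w (hT.sub_X_mul_eq h₁.1 h₂.1 hℓ)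
  rw [map_mul, map_mul, map_mul, map_pow, hD, map_mul, hB] at hid
  set x₃ := T.toAffine.addX x₁ x₂ (T.toAffine.slope x₁ x₂ y₁ y₂) with hx₃
  -- `|x₃ - x₁| s X₂² X₂ = X₂ s² |y₂|`, and `|y₂| Z = X₂`, `X₂ Z² = 1`
  have hsub : w (x₃ - x₁) = s * Z := by
    have hwy₂ : w y₂ = X₂ ^ 2 * Z := by
      calc w y₂ = w y₂ * (X₂ * Z ^ 2) := by rw [hXZ, mul_one]
        _ = (w y₂ * Z) * X₂ * Z := by ring
        _ = X₂ * X₂ * Z := by rw [hYX]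
        _ = X₂ ^ 2 * Z := by ring
    have h1 : w (x₃ - x₁) * (s * X₂ ^ 2 * X₂) = s * Z * (s * X₂ ^ 2 * X₂) := by
      calc w (x₃ - x₁) * (s * X₂ ^ 2 * X₂) = w (x₃ - x₁) * s * X₂ ^ 2 * X₂ := by ring
        _ = X₂ * (s ^ 2 * w y₂) := hid
        _ = X₂ * (s ^ 2 * (X₂ ^ 2 * Z)) := by rw [hwy₂]
        _ = s * Z * (s * X₂ ^ 2 * X₂) := by ring
    exact mul_right_cancel₀ (by positivity) h1
  refine ⟨x₃, _, _, WeierstrassCurve.Affine.Point.add_of_X_ne hxne, hsub, ?_⟩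
  have hlt' : w (x₃ - x₁) < w x₁ := by
    rw [hsub]
    calc s * Z < s * 1 := mul_lt_mul_of_pos_left hZ1 hs0
      _ = s := mul_one _
  have := Valuation.map_add_eq_of_lt_left w hlt'
  rwa [add_sub_cancel] at this

end GroupLaw

/-! ## §4 The level of a top torsion point: `|x(P)|^p = |a₆|` -/

section TopLevel

/-- `-P` is small iff `P` is (same `x`). [folklore] -/
theorem isSmall_neg_iff {P : T.toAffine.Point} : IsSmall w (-P) ↔ IsSmall w P := by
  rcases P with _ | ⟨x, y, h⟩ <;> exact Iff.rfl

variable [DecidableEq L]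

/-- Core of `pow_addOrderOf_eq_of_top`: the first-branch case.
[cite: SilvermanATAEC1994, V.4 Lemmas 4.1.1–4.1.4 (PDF pp. 402–405)] -/
theorem pow_addOrderOf_eq_of_top_of_branch₀ (hT : IsTateForm w T) (ha₆ : T.a₆ ≠ 0) {p : ℕ}
    (hp : p.Prime) (hp2 : p ≠ 2) {x y : L} {h : T.toAffine.Nonsingular x y} (hx : w x < 1)
    (hmid : w T.a₆ < w x ^ 2) (hy : w y < w x)
    (hord : addOrderOf (.some x y h : T.toAffine.Point) = p)
    (htop : ∀ (k : ℕ) (x' y' : L) (h' : T.toAffine.Nonsingular x' y'),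
      k • (.some x y h : T.toAffine.Point) = .some x' y' h' → w x' < 1 → w x' ≤ w x)
    (hns : ∀ k : ℕ, ¬ IsSmall w (k • (.some x y h : T.toAffine.Point)) →
      k • (.some x y h : T.toAffine.Point) = 0) :
    w x ^ p = w T.a₆ := by
  set t := w x with ht
  set n₀ := w T.a₆ with hn₀
  have ht0 : 0 < t := lt_of_le_of_lt zero_le hy
  have hn0 : 0 < n₀ := hT.w_a₆_pos ha₆
  have hPk : ∀ k : ℕ, k • (WeierstrassCurve.Affine.Point.some x y h) = 0 ↔ p ∣ k := fun k ↦ by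
    rw [← hord, addOrderOf_dvd_iff_nsmul_eq_zero]
  have hsome_ne : ∀ (k : ℕ) (x' y' : L) (h' : T.toAffine.Nonsingular x' y'),
      k • (WeierstrassCurve.Affine.Point.some x y h) = .some x' y' h' → ¬ p ∣ k :=
      fun k x' y' h' hk hpk ↦ by
    rw [← hPk, hk] at hpk
    exact WeierstrassCurve.Affine.Point.some_ne_zero _ hpk
  have hp2' : ¬ p ∣ 2 := fun h2 ↦ hp2 ((Nat.prime_dvd_prime_iff_eq hp Nat.prime_two).mp h2)
  -- a middle multiple `C = k • P` (`|x(C)|² ≤ |a₆|`) is impossible: `2C ∈ E₀` would vanish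
  have hnomid : ∀ (k : ℕ) (x' y' : L) (h' : T.toAffine.Nonsingular x' y'),
      k • (WeierstrassCurve.Affine.Point.some x y h) = .some x' y' h' → w x' < 1 →
        ¬ w x' ^ 2 ≤ n₀ := by
    intro k x' y' h' hk hx' hle
    have h2 := not_isSmall_two_nsmul_of_middle hT ha₆ h' hx' hle
    rw [← hk, ← two_nsmul, smul_smul] at h2
    have h0 := hns _ h2
    rw [hPk] at h0
    rcases (Nat.Prime.dvd_mul hp).mp h0 with h | h
    · exact hp2' h
    · exact hsome_ne k x' y' h' hk h
  -- Phase 1: down the first branch, `|x(kP)| = t^k` while `t^{2k} > |a₆|`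
  have desc : ∀ k : ℕ, 1 ≤ k → n₀ < t ^ (2 * k) →
      ∃ (x' y' : L) (h' : T.toAffine.Nonsingular x' y'),
        k • (WeierstrassCurve.Affine.Point.some x y h) = .some x' y' h' ∧ w x' = t ^ k ∧
          w y' < w x' := by
    intro k hk
    induction k, hk using Nat.le_induction with
    | base => intro _; exact ⟨x, y, h, one_nsmul _, (pow_one _).symm, hy⟩
    | succ k hk ih =>
      intro hlt2
      have hlt2' : n₀ < t ^ (2 * k) :=
        lt_of_lt_of_le hlt2 (pow_le_pow_of_le_one zero_le hx.le (by omega))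
      obtain ⟨xk, yk, hk', hkP, hwxk, hwyk⟩ := ih hlt2'
      rcases (show k = 1 ∨ 2 ≤ k by omega) with rfl | hk2
      · rw [one_nsmul] at hkP
        simp only [WeierstrassCurve.Affine.Point.some.injEq] at hkP
        obtain ⟨rfl, rfl⟩ := hkP
        have h4 : n₀ < t ^ 4 := by simpa using hlt2
        obtain ⟨x₃, y₃, h₃, hsum, hwx₃, hwy₃⟩ :=
          two_nsmul_of_branch₀_of_lt_pow_four hT h hx hy h4
        exact ⟨x₃, y₃, h₃, by rw [succ_nsmul, one_nsmul, hsum], hwx₃.trans (by ring), hwy₃⟩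
      · have hltk : w xk < w x := by
          rw [hwxk]
          calc t ^ k < t ^ 1 := pow_lt_pow_right_of_lt_one₀ ht0 hx (by omega)
            _ = t := pow_one _
        have hm₁ : n₀ < w xk ^ 2 := by rw [hwxk, ← pow_mul, mul_comm]; exact hlt2'
        have hprod : n₀ < (w xk * w x) ^ 2 := by
          rw [hwxk]
          calc n₀ < t ^ (2 * (k + 1)) := hlt2
            _ = (t ^ k * t) ^ 2 := by ring
        obtain ⟨x₃, y₃, h₃, hsum, hwx₃, hwy₃⟩ :=
          add_of_branch₀_of_lt_of_lt_sq hT hk' h hx hltk hm₁ hwyk hy hprod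
        exact ⟨x₃, y₃, h₃, by rw [succ_nsmul, hkP, hsum], by rw [hwx₃, hwxk]; ring, hwy₃⟩
  -- `k₀`: the last level above the middle
  have hex : ∃ k : ℕ, 1 ≤ k ∧ t ^ (2 * (k + 1)) ≤ n₀ := by
    obtain ⟨n, hn⟩ := exists_pow_lt_of_lt_one hn0 hx
    refine ⟨max n 1, le_max_right _ _, (pow_le_pow_of_le_one zero_le hx.le ?_).trans hn.le⟩
    omega
  classical
  set k₀ := Nat.find hex with hk₀def
  have hk₀ : 1 ≤ k₀ ∧ t ^ (2 * (k₀ + 1)) ≤ n₀ := Nat.find_spec hex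
  have hk₀lt : n₀ < t ^ (2 * k₀) := by
    rcases (show k₀ = 1 ∨ 2 ≤ k₀ by omega) with h1 | h2
    · rw [h1]; simpa using hmid
    · have hmin := Nat.find_min hex (show k₀ - 1 < k₀ by omega)
      rw [not_and, not_le] at hmin
      have := hmin (by omega)
      rwa [show k₀ - 1 + 1 = k₀ by omega] at this
  obtain ⟨x₀', y₀', h₀', hk₀P, hwx₀, hwy₀⟩ := desc k₀ hk₀.1 hk₀lt
  have hlt₀' : w x₀' < w x ∨ k₀ = 1 := by
    rcases (show k₀ = 1 ∨ 2 ≤ k₀ by omega) with h1 | h2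
    · exact Or.inr h1
    · left
      rw [hwx₀]
      calc t ^ k₀ < t ^ 1 := pow_lt_pow_right_of_lt_one₀ ht0 hx (by omega)
        _ = t := pow_one _
  have hm₀ : n₀ < w x₀' ^ 2 := by rw [hwx₀, ← pow_mul, mul_comm]; exact hk₀lt
  -- the middle is never hit
  have hne₀ : t ^ (2 * (k₀ + 1)) ≠ n₀ := by
    intro heq
    rcases hlt₀' with hlt | h1
    · have hprod : (w x₀' * w x) ^ 2 = n₀ := by rw [hwx₀, ← heq]; ring
      obtain ⟨x₃, y₃, h₃, hsum, hsq, hx₃1⟩ :=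
        add_of_branch₀_of_lt_of_sq_eq hT h₀' h hx hlt hm₀ hwy₀ hy hprod
      exact hnomid (k₀ + 1) x₃ y₃ h₃ (by rw [succ_nsmul, hk₀P, hsum]) hx₃1 hsq
    · have h4 : t ^ 4 = n₀ := by rw [← heq, h1]
      obtain ⟨x₃, y₃, h₃, hsum, hsq, hx₃1⟩ :=
        two_nsmul_of_branch₀_of_pow_four_eq hT h hx hmid hy h4
      refine hnomid 2 x₃ y₃ h₃ (by rw [two_nsmul, hsum]) hx₃1 hsq
  have hlt₀ : t ^ (2 * (k₀ + 1)) < n₀ := lt_of_le_of_ne hk₀.2 hne₀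
  -- crossing: `(k₀ + 1) • P` is on the second branch with `|x| t^{k₀+1} = |a₆|`
  have cross : ∃ (x' y' : L) (h' : T.toAffine.Nonsingular x' y'),
      (k₀ + 1) • (WeierstrassCurve.Affine.Point.some x y h) = .some x' y' h' ∧
        w x' * t ^ (k₀ + 1) = n₀ ∧ w (y' + x') < w x' := by
    rcases hlt₀' with hlt | h1
    · have hprod : (w x₀' * w x) ^ 2 < n₀ := by
        calc (w x₀' * w x) ^ 2 = t ^ (2 * (k₀ + 1)) := by rw [hwx₀]; ring
          _ < n₀ := hlt₀
      obtain ⟨x₃, y₃, h₃, hsum, hwx₃, hwy₃⟩ :=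
        add_of_branch₀_of_lt_of_sq_lt hT h₀' h hx hlt hm₀ hwy₀ hy hprod
      refine ⟨x₃, y₃, h₃, by rw [succ_nsmul, hk₀P, hsum], ?_, hwy₃⟩
      rw [hn₀, ← hwx₃, hwx₀, ht]; ring
    · have h4 : t ^ 4 < n₀ := by rw [h1] at hlt₀; simpa using hlt₀
      obtain ⟨x₃, y₃, h₃, hsum, hwx₃, hwy₃⟩ :=
        two_nsmul_of_branch₀_of_pow_four_lt hT h hx hmid hy h4
      refine ⟨x₃, y₃, h₃, by rw [h1, two_nsmul, hsum], ?_, hwy₃⟩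
      rw [h1]
      simpa [ht, hn₀] using hwx₃
  -- Phase 2: up the second branch, `|x((k₀+1+m)P)| t^{k₀+1+m} = |a₆|` while below the top
  have asc : ∀ m : ℕ, (∀ m' < m, n₀ < t ^ (k₀ + 2 + m')) →
      ∃ (x' y' : L) (h' : T.toAffine.Nonsingular x' y'),
        (k₀ + 1 + m) • (WeierstrassCurve.Affine.Point.some x y h) = .some x' y' h' ∧
          w x' * t ^ (k₀ + 1 + m) = n₀ ∧
          w (y' + x') < w x' := by
    intro m
    induction m with
    | zero => intro _; simpa using cross
    | succ m ih =>
      intro hcond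
      obtain ⟨xm, ym, hm', hmP, hwxm, hwym⟩ := ih fun m' hm' ↦ hcond m' (by omega)
      have hc := hcond m (by omega)
      have hpos : 0 < t ^ (k₀ + 1 + m) := pow_pos ht0 _
      have hltm : w xm < w x := by
        refine lt_of_mul_lt_mul_right ?_ (zero_le : (0 : ℝ≥0) ≤ t ^ (k₀ + 1 + m))
        calc w xm * t ^ (k₀ + 1 + m) = n₀ := hwxm
          _ < t ^ (k₀ + 2 + m) := hc
          _ = w x * t ^ (k₀ + 1 + m) := by rw [← ht]; ring
      have hmm : n₀ < w xm ^ 2 := by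
        -- `n₀ t^{2(k₀+1+m)} ≤ n₀ t^{2(k₀+1)} < n₀² = (|x_m| t^{k₀+1+m})²`
        have h1 : n₀ * (t ^ (k₀ + 1 + m)) ^ 2 < w xm ^ 2 * (t ^ (k₀ + 1 + m)) ^ 2 := by
          calc n₀ * (t ^ (k₀ + 1 + m)) ^ 2 = n₀ * t ^ (2 * (k₀ + 1 + m)) := by ring
            _ ≤ n₀ * t ^ (2 * (k₀ + 1)) :=
                mul_le_mul_of_nonneg_left (pow_le_pow_of_le_one zero_le hx.le (by omega)) zero_le
            _ < n₀ * n₀ := mul_lt_mul_of_pos_left hlt₀ hn0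
            _ = (w xm * t ^ (k₀ + 1 + m)) ^ 2 := by rw [hwxm, sq]
            _ = w xm ^ 2 * (t ^ (k₀ + 1 + m)) ^ 2 := by ring
        exact lt_of_mul_lt_mul_right h1 zero_le
      obtain ⟨x₃, y₃, h₃, hsum, hwx₃, hwy₃⟩ :=
        add_of_branch₁_of_branch₀_of_lt hT hm' h hx hltm hmm hwym hy
      refine ⟨x₃, y₃, h₃, ?_, ?_, hwy₃⟩
      · rw [show k₀ + 1 + (m + 1) = (k₀ + 1 + m) + 1 by ring, succ_nsmul, hmP, hsum]
      · calc w x₃ * t ^ (k₀ + 1 + (m + 1)) = (w x₃ * w x) * t ^ (k₀ + 1 + m) := by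
              rw [← ht]; ring
          _ = n₀ := by rw [hwx₃, hwxm]
  -- `m₁`: the first time the second branch reaches the top level `t`
  have hex₁ : ∃ m : ℕ, t ^ (k₀ + 2 + m) ≤ n₀ := by
    obtain ⟨n, hn⟩ := exists_pow_lt_of_lt_one hn0 hx
    exact ⟨n, (pow_le_pow_of_le_one zero_le hx.le (by omega)).trans hn.le⟩
  set m₁ := Nat.find hex₁ with hm₁def
  have hm₁ : t ^ (k₀ + 2 + m₁) ≤ n₀ := Nat.find_spec hex₁
  have hm₁min : ∀ m' < m₁, n₀ < t ^ (k₀ + 2 + m') := fun m' hm' ↦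
    lt_of_not_ge (Nat.find_min hex₁ hm')
  obtain ⟨xC, yC, hC', hCP, hwxC, hwyC⟩ := asc m₁ hm₁min
  have hposC : 0 < t ^ (k₀ + 1 + m₁) := pow_pos ht0 _
  -- `C = (k₀+1+m₁) • P` is small …
  have hxC1 : w xC < 1 := by
    have hlt : n₀ < t ^ (k₀ + 1 + m₁) := by
      rcases Nat.eq_zero_or_pos m₁ with h0 | hpos
      · rw [h0, add_zero]
        exact lt_of_lt_of_le hk₀lt (pow_le_pow_of_le_one zero_le hx.le (by omega))
      · have := hm₁min (m₁ - 1) (by omega)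
        rwa [show k₀ + 2 + (m₁ - 1) = k₀ + 1 + m₁ by omega] at this
    refine lt_of_mul_lt_mul_right ?_ (zero_le : (0 : ℝ≥0) ≤ t ^ (k₀ + 1 + m₁))
    rw [hwxC, one_mul]; exact hlt
  -- … hence at level `≤ t` (top), and `≥ t` by the choice of `m₁`: so `|a₆| = t^N`
  have hwxCt : w xC = t := by
    refine le_antisymm (htop _ xC yC hC' hCP hxC1) ?_
    refine le_of_mul_le_mul_right ?_ hposC
    calc t * t ^ (k₀ + 1 + m₁) = t ^ (k₀ + 2 + m₁) := by ring
      _ ≤ n₀ := hm₁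
      _ = w xC * t ^ (k₀ + 1 + m₁) := hwxC.symm
  set N := k₀ + 2 + m₁ with hNdef
  have hNa₆ : t ^ N = n₀ := by
    rw [← hwxC, hwxCt]; ring
  -- terminal step: `N • P = C + P = 0`
  have hNP : N • (WeierstrassCurve.Affine.Point.some x y h) = 0 := by
    have hNsucc : N • (WeierstrassCurve.Affine.Point.some x y h) =
        (k₀ + 1 + m₁) • (WeierstrassCurve.Affine.Point.some x y h) +
          (WeierstrassCurve.Affine.Point.some x y h) := by
      rw [show N = (k₀ + 1 + m₁) + 1 by omega, succ_nsmul]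
    rw [hNsucc, hCP]
    by_cases hxx : xC = x
    · have hCx : T.toAffine.Equation x yC := hxx ▸ hC'.1
      rcases y_eq_or_eq_neg_of_x_eq hT h.1 hCx with hyy | hyy
      · -- `C = P`: but `C` is on the second branch and `P` on the first
        exfalso
        rw [hyy, hxx] at hwyC
        exact not_branch₁_of_branch₀ hy hwyC
      · -- `C = -P`
        have hyC : yC = T.toAffine.negY x y := by rw [hT.negY]; linear_combination hyy
        have hneg : (.some xC yC hC' : T.toAffine.Point) =
            -(WeierstrassCurve.Affine.Point.some x y h) := by
          rw [WeierstrassCurve.Affine.Point.neg_some]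
          simp only [WeierstrassCurve.Affine.Point.some.injEq]
          exact ⟨hxx, hyC⟩
        rw [hneg, neg_add_cancel]
    · have hns' := not_isSmall_add_of_branch₁_of_branch₀ hT hC' h hx hwxCt hxx
        (by rw [hwxCt]; exact hmid) hwyC hy
      have := hns N (by rwa [hNsucc, hCP])
      rwa [hNsucc, hCP] at this
  -- `p ∣ N`, and no `k • P` with `1 ≤ k < N` vanishes, while `p • P = 0`: so `p = N`
  have hpN : p ∣ N := (hPk N).mp hNP
  have hsmall : ∀ k, 1 ≤ k → k < N → k • (WeierstrassCurve.Affine.Point.some x y h) ≠ 0 := by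
    intro k hk1 hkN
    rcases le_or_gt k k₀ with hle | hlt
    · obtain ⟨x', y', h', hk, -, -⟩ := desc k hk1
        (lt_of_lt_of_le hk₀lt (pow_le_pow_of_le_one zero_le hx.le (by omega)))
      rw [hk]; exact WeierstrassCurve.Affine.Point.some_ne_zero _
    · obtain ⟨m, rfl⟩ : ∃ m, k = k₀ + 1 + m := ⟨k - (k₀ + 1), by omega⟩
      obtain ⟨x', y', h', hk, -, -⟩ := asc m fun m' hm' ↦ hm₁min m' (by omega)
      rw [hk]; exact WeierstrassCurve.Affine.Point.some_ne_zero _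
  have hpP : p • (WeierstrassCurve.Affine.Point.some x y h) = 0 := (hPk p).mpr dvd_rfl
  have hNp : N ≤ p := by
    by_contra hlt
    exact hsmall p hp.one_lt.le (lt_of_not_ge hlt) hpP
  have hN0 : 0 < N := by omega
  have hpN' : p = N := le_antisymm (Nat.le_of_dvd hN0 hpN) hNp
  rw [hpN', hNa₆]

/-- **The level of a top torsion point of a Tate form is `|a₆|^{1/p}`.**  Let `T` be a Tate form
for `w` with `a₆ ≠ 0`, `p` an odd prime and `P = (x, y)` a small point (`|x| < 1`) of order `p`
such that (i) no small multiple `k • P = (x', y')` has `|x'| > |x|` and (ii) every non-small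
multiple of `P` vanishes.  Then `|x|^p = |a₆|`.
On the Tate curve `E_q` (`|a₆(q)| = |q|`) this is the statement that a `p`-torsion point of
`E_q(K̄) ≅ K̄ˣ/q^ℤ` outside `μ_p` is `ζ q^{a/p}` and the top one has `|x| = |u| = |q|^{1/p}`;
the proof here is elementary: follow `P, 2P, …` down the first branch of the node
(`add_of_branch₀_of_lt_of_lt_sq`, levels multiply), across the middle
(`add_of_branch₀_of_lt_of_sq_lt`; landing ON the middle is excluded by (ii) and `p` odd, since
twice a middle point lies in `E₀`), and up the second branch (`add_of_branch₁_of_branch₀_of_lt`)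
until the top level `t` is reached at `(N - 1) • P`, where `t^N = |a₆|`; then `N • P ∈ E₀` vanishes,
no earlier multiple does, and `p = N`.
[cite: SilvermanATAEC1994, V.3 Thm. 3.1 and V.4 Lemmas 4.1.1–4.1.4 (PDF pp. 395, 402–405)] -/
theorem pow_addOrderOf_eq_of_top (hT : IsTateForm w T) (ha₆ : T.a₆ ≠ 0) {p : ℕ}
    (hp : p.Prime) (hp2 : p ≠ 2) {x y : L} {h : T.toAffine.Nonsingular x y} (hx : w x < 1)
    (hord : addOrderOf (.some x y h : T.toAffine.Point) = p)
    (htop : ∀ (k : ℕ) (x' y' : L) (h' : T.toAffine.Nonsingular x' y'),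
      k • (.some x y h : T.toAffine.Point) = .some x' y' h' → w x' < 1 → w x' ≤ w x)
    (hns : ∀ k : ℕ, ¬ IsSmall w (k • (.some x y h : T.toAffine.Point)) →
      k • (.some x y h : T.toAffine.Point) = 0) :
    w x ^ p = w T.a₆ := by
  -- `P` is not a middle point: `2P ∈ E₀` would give `2P = 0`
  have hmid : w T.a₆ < w x ^ 2 := by
    by_contra hle
    rw [not_lt] at hle
    have h2 := not_isSmall_two_nsmul_of_middle hT ha₆ h hx hle
    rw [← two_nsmul] at h2
    have h0 := hns 2 h2
    rw [← addOrderOf_dvd_iff_nsmul_eq_zero, hord] at h0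
    exact hp2 ((Nat.prime_dvd_prime_iff_eq hp Nat.prime_two).mp h0)
  rcases branch hT h.1 hx hmid with hb | hb
  · exact pow_addOrderOf_eq_of_top_of_branch₀ hT ha₆ hp hp2 hx hmid hb.1 hord htop hns
  · -- second branch: apply the first-branch case to `-P = (x, -y - x)`
    have hn : T.toAffine.Nonsingular x (T.toAffine.negY x y) :=
      (WeierstrassCurve.Affine.nonsingular_neg ..).mpr h
    have hneg : -(.some x y h : T.toAffine.Point) = .some x (T.toAffine.negY x y) hn := rfl
    have hy' : w (T.toAffine.negY x y) < w x := by
      rw [hT.negY, show -y - x = -(y + x) by ring, Valuation.map_neg]; exact hb.1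
    refine pow_addOrderOf_eq_of_top_of_branch₀ hT ha₆ hp hp2 (h := hn) hx hmid hy' ?_ ?_ ?_
    · rw [← hneg, addOrderOf_neg, hord]
    · intro k x' y' h' hk hx'
      rw [← hneg, neg_nsmul, neg_eq_iff_eq_neg] at hk
      have hk' : k • (.some x y h : T.toAffine.Point) = .some x' (T.toAffine.negY x' y')
          ((WeierstrassCurve.Affine.nonsingular_neg ..).mpr h') := by rw [hk]; rfl
      exact htop k x' _ _ hk' hx'
    · intro k hk
      rw [← hneg, neg_nsmul] at hk ⊢
      rw [neg_eq_zero]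
      refine hns k fun hs ↦ hk ?_
      exact isSmall_neg_iff.mpr hs

end TopLevel

end TateForm

end Literature.NumberTheory.EllipticCurves
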